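import Literature.MathematicalPhysics.PowerSystems.DroopSyncExponentialStability
import HarnessLib

/-!
# SPDB2013 Theorem 2 (i), stability clause, WITH LOAD NODES (`V_L ≠ ∅`): the differential-algebraic
# closed loop, the Kron-reduced linearisation `−D_I⁻¹L_red(θ*)`, and local exponential stability of
# the synchronized solution

Topic `Literature/MathematicalPhysics/PowerSystems` (LADDER-GRIDFUSION rung G3; seat gridfusion-lit-2,
g9).  Companion of `DroopSyncExponentialStability.lean`, which types Theorem 2 (i)'s stability
clause for ALL-INVERTER networks (`V_L = ∅`) and recorded «Load nodes (`D_i = 0`, the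
differential-algebraic case of Theorem 2, handled in print by the index-1 reduction
`L_red = L_II − L_IL L_LL⁻¹ L_LI`)» as NOT typed.  This file types it.  Everything is PROVED (no
named fact, no `sorry`), through Lyapunov's indirect method in the rotation-quotient form
(`Literature/Analysis/ODE/LyapunovIndirectMethod.lean`).

SOURCE (held LaTeX text of arXiv:1206.5033 = Automatica 49 (2013) 2603–2611, read on the page this
session) [SimpsonporcoDorflerBullo2013]: §3 Theorem 2 (p0007 L71–L77: «the closed-loop system
(KuraDroop)–(PowerBal) possess a locally exponentially stable and unique synchronized solution»);
proof (p0008 L23–L49): the auxiliary system (Aux) `Dθ̇ = P̃ − B diag(a_ij) sin(Bᵀθ)` with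
`P̃_i = P_i*` for `i ∈ V_L`, `P̃_i = P_i* − ω_avg D_i` for `i ∈ V_I`; the linearisation
`d/dt (0, Δθ_I) = −blkdiag(I, D_I⁻¹) [[L_LL, L_LI],[L_IL, L_II]] (Δθ_L, Δθ_I)`; «the upper left
block `L_LL` of `L(θ*)` is nonsingular …, or equivalently, `θ*` is a regular equilibrium point.
Solving the set of `|V_L|` algebraic equations and substituting into the dynamics for `Δθ_I`, we
obtain `d(Δθ_I)/dt = −D_I⁻¹L_red(θ*)Δθ_I`, where `L_red ≜ L_II − L_IL L_LL⁻¹ L_LI`. The matrix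
`L_red(θ*)` … is also a Laplacian matrix».

WHAT IS PROVED, for `N : DroopNetwork n` with `D_i ≥ 0` (inverters `Inv = {D_i > 0}`, loads
`Load = {¬ D_i > 0}`), at least one inverter, `|Y|` symmetric, an (Aux)-equilibrium `θ₀`:
* §1–§2 `lapLL/lapLI/lapIL/lapI/lapL` (blocks of `L(θ)`), `mismatch` (`P̃ − P_e(θ)`), `elim`
  (`G(θ) = −L_LL(θ)⁻¹L_LI(θ)`), `hasFDerivAt_mismatch` (`Dm = −L(θ*)`), **`isUnit_lapLL_det`**
  (`L_LL(θ*)` invertible from the PSD + kernel certificate of the Hessian form and one inverter),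
  `sum_lapIL_mul_inv` (`𝟙ᵀL_IL L_LL⁻¹ = −𝟙ᵀ`), `lapLL_mul_elim`;
* §3 the ODE EXTENSION `kronField θ₀` of the DAE near `θ₀` (inverter rows
  `(m_i − (L_IL L_LL⁻¹ m_L)_i)/D_i`, load rows `G(θ)F_I + L_LL(θ₀)⁻¹m_L` — it coincides with the
  DAE velocities on the constraint manifold `m_L = 0`), its rotational symmetry, the conserved
  quantity `Σ_{V_I} D_iθ_i` (`dc_dotProduct_kronField`), `kronField_equilibrium`, its Jacobian
  `kronJac θ₀` (`= −D_I⁻¹L_red(θ₀)` on the inverter block, `−1` transversally) and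
  **`hasFDerivAt_kronField`** (the elimination matrix is only CONTINUOUS at `θ₀`; the product rule
  at a zero, `hasFDerivAt_mul_of_eq_zero`, suffices);
* §4 **`kronJac_eig_re_neg_or_rotation`** — the spectral sentence PROVED: every complex eigenpair
  has `Re μ < 0` (`μ = −1` off the linearised constraint; on it the reduced Laplacian argument with
  the full Hessian form) or is the rotation mode;
* §5 `kron_expStable_within_leaf`, `kron_expStable_modRotation_of_within_leaf`;
* §6 `hasDerivAt_kronField_of_constraint` (differentiating the load constraints along a DAE
  solution gives `θ̇ = F(θ)` while `L_LL(θ(t))` is invertible), `exists_ball_isUnit_lapLL`,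
  `frame_of_isSolutionAt`, and **`syncSolution_locally_expStable_loads`** (certificate form) /
  **`syncSolution_locally_expStable_loads_of_arc`** (printed hypotheses `θ₀ ∈ Δ_G(γ)`, `γ < π/2`,
  `a ≥ 0` connected): `∃ ρ, k, λ > 0`, every solution `θ` of the DIFFERENTIAL-ALGEBRAIC closed loop
  (`DroopNetwork.IsSolutionAt` at every time: inverter rows (KuraDroop), load rows (PowerBal)) with
  `‖θ(0) − θ₀‖ < ρ` satisfies `‖θ(t) − (θ₀ + c𝟙 + ω_avg t 𝟙)‖ ≤ k‖θ(0) − (θ₀ + c𝟙)‖e^{−λt}` for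
  `t ≥ 0`, `c = Σ_i D_i(θ_i(0) − θ₀,i)/Σ_i D_i` — the same sentence as the all-inverter theorem
  `syncSolution_locally_expStable`, now with load nodes; a bootstrap (continuous induction on the
  first time `L_LL(θ(t))` would become singular) keeps the solution in the regular region;
* §7 **`flowFeasible_iff_exists_unique_expStable_sync_loads`** — Theorem 2 (i) ⇔ (ii) WITH
  «locally exponentially stable and unique» on acyclic networks WITH load nodes (the printed
  generality), assembling `flowFeasible_iff_exists_isAuxEquilibrium`
  (`DroopControlledInverters.lean`), uniqueness modulo rotation and §6.

THREE COLUMNS.  Mathematics about MODEL «(CombinedKuraDroop): lossless, inductive lines, constant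
voltage amplitudes, first-order droop at inverters, constant-power (frequency-independent) loads as
algebraic power-balance rows».  `ρ, k, λ` are EXISTENTIAL.  The DAE solution notion is the tree's
(`IsSolutionAt`: every angle differentiable, `D_iθ̇_i = P_i* − P_e,i`, so `0 = P_l* − P_e,l` at
loads); existence of DAE solutions from given initial data is NOT asserted here.  Nothing here says
a microgrid is stable.

## Mathlib / tree search

Tree: `DroopNetwork.{lap, linWeight, lap_mulVec, lap_symm, linWeight_symm, injection_add_const,
sum_injection_eq_zero, sum_shiftedInjection_eq_zero, IsAuxEquilibrium, IsSolutionAt, re_conj_lapForm,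
posCurvature_of_arc, syncSolution_locally_expStable}` (`DroopControlledInverters.lean`,
`DroopSyncExponentialStability.lean`), `ClassicalModel.CouplingConnected`,
`Literature.Analysis.ODE.exists_expStable_within_of_eig_re_neg_or_smul` (used).  Mathlib:
`Matrix.nonsing_inv_mul`, `Matrix.mul_nonsing_inv`, `Matrix.inv_def`, `Matrix.isUnit_iff_isUnit_det`,
`Matrix.mulVec_injective_iff_isUnit`, `Continuous.matrix_det`, `Continuous.matrix_adjugate`,
`Fintype.sum_subtype_add_sum_subtype`, `Asymptotics.IsLittleO.mul_isBigO`, `IsClosed.csInf_mem`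
(used).  `rg -i kron Literature/MathematicalPhysics/PowerSystems`: the word occurs only in prose
(network reduction of admittances in `ClassicalSwingModel.lean`, `StructurePreservingModel.lean`,
`LosslessMultimachineEnergy.lean`, `LossyMultimachineLurieForm.lean`, `DroopMicrogridHamiltonian.lean`);
no prior declaration of the linearised Kron reduction `L_red(θ*)` or of the DAE stability clause.

## References

* J. W. Simpson-Porco, F. Dörfler, F. Bullo, *Synchronization and power sharing for droop-controlled
  inverters in islanded microgrids*, Automatica 49 (2013) 2603–2611 = arXiv:1206.5033, §3 Theorem 2
  and its proof (held text p0007–p0009). [SimpsonporcoDorflerBullo2013]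
* H. K. Khalil, *Nonlinear Systems*, 3rd ed., Theorem 4.7. [Khalil2002]
-/

noncomputable section

open Set Filter Topology Finset
open scoped Matrix ComplexConjugate BigOperators

namespace Literature.MathematicalPhysics.PowerSystems

namespace DroopNetwork

variable {n : ℕ} (N : DroopNetwork n)

/-! ## §1 Inverter and load nodes; the blocks of `L(θ)`; the mismatch `P̃ − P_e(θ)` -/

/-- The inverter nodes `V_I = {i : D_i > 0}` as an index type.
[cite: SimpsonporcoDorflerBullo2013, §3 («`V_I`», eq. (KuraDroop))] -/
abbrev Inv : Type := {i : Fin n // 0 < N.Dc i}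

/-- The load nodes `V_L` (`D_i = 0`; here: not `D_i > 0`) as an index type.
[cite: SimpsonporcoDorflerBullo2013, §3 («`V_L`», eq. (PowerBal))] -/
abbrev Load : Type := {i : Fin n // ¬ 0 < N.Dc i}

/-- The block `L_LL(θ)` of the linearised network Laplacian.
[cite: SimpsonporcoDorflerBullo2013, §3 proof of Theorem 2 (b) (partition of `L(θ*)` by load and inverter nodes)] -/
def lapLL (θ : Fin n → ℝ) : Matrix N.Load N.Load ℝ := fun a b => N.lap θ a.1 b.1

/-- The block `L_LI(θ)`. [cite: SimpsonporcoDorflerBullo2013, §3 proof of Theorem 2 (b)] -/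
def lapLI (θ : Fin n → ℝ) : Matrix N.Load N.Inv ℝ := fun a b => N.lap θ a.1 b.1

/-- The block `L_IL(θ)`. [cite: SimpsonporcoDorflerBullo2013, §3 proof of Theorem 2 (b)] -/
def lapIL (θ : Fin n → ℝ) : Matrix N.Inv N.Load ℝ := fun a b => N.lap θ a.1 b.1

/-- The power mismatch `P̃_i − P_e,i(θ)` (`P̃_i = P*_i − ω_avg D_i`; at a load node `P̃_i = P*_i`).
[cite: SimpsonporcoDorflerBullo2013, §3 proof of Theorem 2, eq. (Aux) and (PowerBal)] -/
def mismatch (θ : Fin n → ℝ) (i : Fin n) : ℝ := N.shiftedInjection i - N.injection θ i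

/-- The state-dependent elimination matrix `G(θ) = −L_LL(θ)⁻¹ L_LI(θ)` (load angle velocities in
terms of inverter velocities on the constraint manifold).
[cite: SimpsonporcoDorflerBullo2013, §3 proof of Theorem 2 (b) («eliminate the resulting algebraic equations»)] -/
def elim (θ : Fin n → ℝ) : Matrix N.Load N.Inv ℝ := -((N.lapLL θ)⁻¹ * N.lapLI θ)

/-- The rows `L_{I,:}(θ)` (inverter rows, all columns). [cite: SimpsonporcoDorflerBullo2013, §3 proof of Theorem 2 (b)] -/
def lapI (θ : Fin n → ℝ) : Matrix N.Inv (Fin n) ℝ := fun i j => N.lap θ i.1 j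

/-- The rows `L_{L,:}(θ)` (load rows, all columns). [cite: SimpsonporcoDorflerBullo2013, §3 proof of Theorem 2 (b)] -/
def lapL (θ : Fin n → ℝ) : Matrix N.Load (Fin n) ℝ := fun l j => N.lap θ l.1 j

/-- **The ODE extension of the differential-algebraic closed loop near `θ*`, inverter rows**:
`F_i(θ) = (m_i(θ) − (L_IL(θ*)L_LL(θ*)⁻¹ m_L(θ))_i)/D_i`, `m = P̃ − P_e(θ)`.  On the constraint
manifold `m_L = 0` this is (Aux); the correction makes `Σ_I D_iF_i ≡ 0` and the linearisation
`−D_I⁻¹ L_red(θ*)` («solving the algebraic equations and substituting»).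
[cite: SimpsonporcoDorflerBullo2013, §3 proof of Theorem 2 (b) (held text p0008 L41–L47)] -/
def kronFieldI (θs θ : Fin n → ℝ) : N.Inv → ℝ := fun i =>
  (N.mismatch θ i.1 - ((N.lapIL θs * (N.lapLL θs)⁻¹) *ᵥ fun l : N.Load => N.mismatch θ l.1) i)
    / N.Dc i.1

/-- **Load rows of the extension**: `F_L(θ) = G(θ)F_I(θ) + L_LL(θ*)⁻¹ m_L(θ)` — the velocity the
constraint `m_L(θ(t)) = 0` forces on the load angles (`L_LL(θ)θ̇_L + L_LI(θ)θ̇_I = 0`), plus a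
term vanishing on the manifold that removes the neutral load directions from the linearisation.
[cite: SimpsonporcoDorflerBullo2013, §3 proof of Theorem 2 (b) («solving the set of `|V_L|` algebraic
equations»)] -/
def kronFieldL (θs θ : Fin n → ℝ) : N.Load → ℝ :=
  N.elim θ *ᵥ N.kronFieldI θs θ + (N.lapLL θs)⁻¹ *ᵥ fun l : N.Load => N.mismatch θ l.1

/-- The extension field on all of `ℝⁿ`. [cite: SimpsonporcoDorflerBullo2013, §3 proof of Theorem 2 (b)] -/
def kronField (θs θ : Fin n → ℝ) : Fin n → ℝ := fun j =>
  if h : 0 < N.Dc j then N.kronFieldI θs θ ⟨j, h⟩ else N.kronFieldL θs θ ⟨j, h⟩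

/-- The Jacobian of the extension at `θ*`, inverter rows: `−D_I⁻¹(L_{I,:} − L_IL L_LL⁻¹ L_{L,:})`,
whose restriction to the inverter columns is `−D_I⁻¹L_red(θ*)` and whose load columns vanish.
[cite: SimpsonporcoDorflerBullo2013, §3 proof of Theorem 2 (b) («`d(Δθ_I)/dt = −D_I⁻¹L_red(θ*)Δθ_I`»)] -/
def kronJacI (θs : Fin n → ℝ) : Matrix N.Inv (Fin n) ℝ :=
  Matrix.diagonal (fun i : N.Inv => -(N.Dc i.1)⁻¹) * (N.lapI θs - N.lapIL θs * (N.lapLL θs)⁻¹ * N.lapL θs)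

/-- Load rows of the Jacobian: `G(θ*)J_I − L_LL(θ*)⁻¹L_{L,:}(θ*)`. [cite: SimpsonporcoDorflerBullo2013, §3 proof of Theorem 2 (b)] -/
def kronJacL (θs : Fin n → ℝ) : Matrix N.Load (Fin n) ℝ :=
  N.elim θs * N.kronJacI θs - (N.lapLL θs)⁻¹ * N.lapL θs

/-- The Jacobian of the extension field at `θ*` as a matrix on all nodes.
[cite: SimpsonporcoDorflerBullo2013, §3 proof of Theorem 2 (b)] -/
def kronJac (θs : Fin n → ℝ) : Matrix (Fin n) (Fin n) ℝ := fun j' j =>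
  if h : 0 < N.Dc j' then N.kronJacI θs ⟨j', h⟩ j else N.kronJacL θs ⟨j', h⟩ j

variable {N}

/-- Splitting a sum over the nodes into inverter and load nodes. [folklore] -/
private theorem sum_split {M : Type*} [AddCommMonoid M] (f : Fin n → M) :
    ∑ j, f j = ∑ i : N.Inv, f i.1 + ∑ l : N.Load, f l.1 :=
  (Fintype.sum_subtype_add_sum_subtype (fun i => 0 < N.Dc i) f).symm

/-- A load node has `D_l = 0` when all `D_i ≥ 0`. [cite: SimpsonporcoDorflerBullo2013, §3 («`D_i = 0` for `i ∈ V_L`»)] -/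
theorem dc_load (hD : ∀ i, 0 ≤ N.Dc i) (l : N.Load) : N.Dc l.1 = 0 :=
  le_antisymm (not_lt.1 l.2) (hD l.1)

/-- The mismatch only sees angle differences. [cite: SimpsonporcoDorflerBullo2013, §3 proof of Theorem 2 («rotational invariance»)] -/
theorem mismatch_add_const (θ : Fin n → ℝ) (c : ℝ) :
    N.mismatch (fun j => θ j + c) = N.mismatch θ := by
  funext i; simp only [mismatch, injection_add_const]

/-- At an (Aux)-equilibrium every mismatch vanishes. [cite: SimpsonporcoDorflerBullo2013, §3 proof of Theorem 2, eq. (Aux)] -/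
theorem mismatch_eq_zero_of_isAuxEquilibrium {θs : Fin n → ℝ} (h : N.IsAuxEquilibrium θs) :
    N.mismatch θs = 0 := by
  funext i; simp [mismatch, h i]

/-- `Σ_i (P̃_i − P_e,i(θ)) = 0` (`P̃ ∈ 𝟙^⊥`, lossless injections sum to zero).
[cite: SimpsonporcoDorflerBullo2013, §3 proof of Theorem 2 («`P̃ − P_e ∈ 𝟙_n^⊥`»)] -/
theorem sum_mismatch_eq_zero (hY : ∀ i j, N.Yabs i j = N.Yabs j i) (hDs : ∑ i, N.Dc i ≠ 0)
    (θ : Fin n → ℝ) : ∑ i, N.mismatch θ i = 0 := by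
  simp only [mismatch, Finset.sum_sub_distrib, N.sum_shiftedInjection_eq_zero hDs,
    N.sum_injection_eq_zero hY θ, sub_self]

/-- The linearised Laplacian only sees angle differences: `L(θ + c𝟙) = L(θ)`.
[cite: SimpsonporcoDorflerBullo2013, §3 proof of Theorem 2 («rotational invariance»)] -/
theorem lap_add_const (θ : Fin n → ℝ) (c : ℝ) : N.lap (fun j => θ j + c) = N.lap θ := by
  have h : ∀ i j, N.linWeight (fun j => θ j + c) i j = N.linWeight θ i j := by
    intro i j; simp only [linWeight, add_sub_add_right_eq_sub]
  ext i j
  simp only [lap, h]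

/-- `L_LL(θ + c𝟙) = L_LL(θ)`. [cite: SimpsonporcoDorflerBullo2013, §3 proof of Theorem 2 («rotational invariance»)] -/
theorem lapLL_add_const (θ : Fin n → ℝ) (c : ℝ) : N.lapLL (fun j => θ j + c) = N.lapLL θ := by
  ext a b; simp only [lapLL, lap_add_const]

/-- `L_LI(θ + c𝟙) = L_LI(θ)`. [cite: SimpsonporcoDorflerBullo2013, §3 proof of Theorem 2 («rotational invariance»)] -/
theorem lapLI_add_const (θ : Fin n → ℝ) (c : ℝ) : N.lapLI (fun j => θ j + c) = N.lapLI θ := by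
  ext a b; simp only [lapLI, lap_add_const]

/-- **The linearisation of the mismatch IS `−L(θ*)`**: `θ ↦ P̃_i − P_e,i(θ)` has Fréchet derivative
`h ↦ −(L(θ*)h)_i` at `θ*` (every node, load nodes included).
[cite: SimpsonporcoDorflerBullo2013, §3 proof of Theorem 2 (b) («the Jacobian … `−L(θ*)`»)] -/
theorem hasFDerivAt_mismatch (θs : Fin n → ℝ) (i : Fin n) :
    HasFDerivAt (fun θ => N.mismatch θ i)
      (-(∑ j, N.linWeight θs i j •
        ((ContinuousLinearMap.proj i : (Fin n → ℝ) →L[ℝ] ℝ) - ContinuousLinearMap.proj j))) θs := by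
  have hdiff : ∀ j : Fin n, HasFDerivAt (fun θ : Fin n → ℝ => θ i - θ j)
      ((ContinuousLinearMap.proj i : (Fin n → ℝ) →L[ℝ] ℝ) - ContinuousLinearMap.proj j) θs :=
    fun j => (hasFDerivAt_apply i θs).fun_sub (hasFDerivAt_apply j θs)
  have hsin : ∀ j : Fin n, HasFDerivAt (fun θ : Fin n → ℝ => N.a i j * Real.sin (θ i - θ j))
      (N.a i j • (Real.cos (θs i - θs j) •
        ((ContinuousLinearMap.proj i : (Fin n → ℝ) →L[ℝ] ℝ) - ContinuousLinearMap.proj j))) θs :=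
    fun j => ((hdiff j).sin).const_mul (N.a i j)
  have hinj : HasFDerivAt (fun θ : Fin n → ℝ => N.injection θ i)
      (∑ j, N.a i j • (Real.cos (θs i - θs j) •
        ((ContinuousLinearMap.proj i : (Fin n → ℝ) →L[ℝ] ℝ) - ContinuousLinearMap.proj j))) θs :=
    HasFDerivAt.fun_sum (u := Finset.univ) fun j _ => hsin j
  have h1 := (hasFDerivAt_const (N.shiftedInjection i) θs).sub hinj
  simp only [zero_sub] at h1
  refine (h1.congr_of_eventuallyEq (Eventually.of_forall fun θ => rfl)).congr_fderiv ?_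
  congr 1
  refine Finset.sum_congr rfl fun j _ => ?_
  rw [smul_smul]
  rfl

/-- The derivative of the mismatch, applied: `−(L(θ*)h)_i = −Σ_j c_ij (h_i − h_j)`. [folklore] -/
private theorem mismatchDeriv_apply (θs : Fin n → ℝ) (i : Fin n) (h : Fin n → ℝ) :
    ((-(∑ j, N.linWeight θs i j •
        ((ContinuousLinearMap.proj i : (Fin n → ℝ) →L[ℝ] ℝ) - ContinuousLinearMap.proj j)))
        : (Fin n → ℝ) →L[ℝ] ℝ) h
      = -((N.lap θs *ᵥ h) i) := by
  rw [lap_mulVec]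
  simp only [neg_apply, _root_.sum_apply, smul_apply, sub_apply, ContinuousLinearMap.proj_apply,
    smul_eq_mul]

/-! ## §2 `L_LL(θ*)` is invertible; block identities of the Kron reduction -/

/-- The real Laplacian form through `L(θ)`: `Σ_i x_i (L(θ)x)_i = Σ_i x_i Σ_j c_ij (x_i − x_j)`.
[cite: SimpsonporcoDorflerBullo2013, §3 proof of Theorem 2 (b)] -/
theorem dotProduct_lap_mulVec (θ x : Fin n → ℝ) :
    x ⬝ᵥ (N.lap θ *ᵥ x) = ∑ i, x i * ∑ j, N.linWeight θ i j * (x i - x j) := by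
  simp only [dotProduct, lap_mulVec]

/-- **`L_LL(θ*)` is invertible**: with the PSD + kernel certificate of the full Laplacian form at
`θ*` (e.g. the arc) and at least one inverter node, `L_LL(θ*) x = 0` forces `x = 0` («`L_red` is
well defined»). [cite: SimpsonporcoDorflerBullo2013, §3 proof of Theorem 2 (b) («`L_LL` is
nonsingular … `L_red = L_II − L_IL L_LL⁻¹ L_LI`»)] -/
theorem isUnit_lapLL_det {θs : Fin n → ℝ}
    (hker : ∀ u : Fin n → ℝ, ∑ i, u i * ∑ j, N.linWeight θs i j * (u i - u j) = 0 →
      ∃ a : ℝ, u = fun _ => a)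
    (i₀ : N.Inv) : IsUnit (N.lapLL θs).det := by
  classical
  rw [← Matrix.isUnit_iff_isUnit_det, ← Matrix.mulVec_injective_iff_isUnit]
  -- injectivity of `x ↦ L_LL x` from the form
  suffices hker0 : ∀ x : N.Load → ℝ, N.lapLL θs *ᵥ x = 0 → x = 0 by
    intro x y hxy
    have h := hker0 (x - y) (by rw [Matrix.mulVec_sub, hxy, sub_self])
    exact sub_eq_zero.1 h
  intro x hx
  -- extend `x` by zero on the inverter nodes
  set X : Fin n → ℝ := fun j => if hj : 0 < N.Dc j then 0 else x ⟨j, hj⟩ with hX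
  have hXl : ∀ l : N.Load, X l.1 = x l := fun l => by simp [hX, l.2]
  have hXi : ∀ i : N.Inv, X i.1 = 0 := fun i => by simp [hX, i.2]
  have hLX : ∀ l : N.Load, (N.lap θs *ᵥ X) l.1 = (N.lapLL θs *ᵥ x) l := by
    intro l
    simp only [Matrix.mulVec, dotProduct, lapLL]
    rw [sum_split (N := N)]
    simp only [hXi, mul_zero, Finset.sum_const_zero, zero_add, hXl]
  have hform : ∑ i, X i * ∑ j, N.linWeight θs i j * (X i - X j) = 0 := by
    rw [← dotProduct_lap_mulVec, dotProduct, sum_split (N := N)]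
    simp only [hXi, zero_mul, Finset.sum_const_zero, zero_add, hLX, hx, Pi.zero_apply, mul_zero]
  obtain ⟨a, ha⟩ := hker X hform
  have ha0 : a = 0 := by have := congrFun ha i₀.1; rw [hXi] at this; exact this.symm
  funext l
  have := congrFun ha l.1
  rw [hXl, ha0] at this
  exact this

/-- Column sums of the Laplacian vanish (symmetric weights): `Σ_i L(θ)_ij = 0`.
[cite: SimpsonporcoDorflerBullo2013, §3 proof of Theorem 2 (b) («Laplacian»)] -/
theorem sum_lap_col (hY : ∀ i j, N.Yabs i j = N.Yabs j i) (θ : Fin n → ℝ) (j : Fin n) :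
    ∑ i, N.lap θ i j = 0 := by
  have hrow : ∑ i, N.lap θ j i = 0 := by
    have := lap_mulVec (N := N) θ (fun _ => (1 : ℝ)) j
    simp only [Matrix.mulVec, dotProduct, mul_one, sub_self, mul_zero, Finset.sum_const_zero] at this
    exact this
  rw [← hrow]
  exact Finset.sum_congr rfl fun i _ => lap_symm hY θ i j

/-- **Column identity of the Kron reduction**: `𝟙_Iᵀ L_IL L_LL⁻¹ = −𝟙_Lᵀ`, i.e.
`Σ_{i ∈ V_I} (L_IL L_LL⁻¹)_{il} = −1` for every load node `l` (`L_LL` invertible, symmetric weights).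
[cite: SimpsonporcoDorflerBullo2013, §3 proof of Theorem 2 (b)] -/
theorem sum_lapIL_mul_inv (hY : ∀ i j, N.Yabs i j = N.Yabs j i) {θs : Fin n → ℝ}
    (hU : IsUnit (N.lapLL θs).det) (l : N.Load) :
    ∑ i : N.Inv, (N.lapIL θs * (N.lapLL θs)⁻¹) i l = -1 := by
  classical
  -- `𝟙_Iᵀ L_IL = −𝟙_Lᵀ L_LL` (zero column sums), then multiply by `L_LL⁻¹`
  have hcol : ∀ l' : N.Load, ∑ i : N.Inv, N.lapIL θs i l' = -∑ l'' : N.Load, N.lapLL θs l'' l' := by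
    intro l'
    have h := sum_lap_col hY θs l'.1
    rw [sum_split (N := N)] at h
    simp only [lapIL, lapLL]
    linarith
  have h1 : ∑ i : N.Inv, (N.lapIL θs * (N.lapLL θs)⁻¹) i l
      = ∑ l' : N.Load, (∑ i : N.Inv, N.lapIL θs i l') * (N.lapLL θs)⁻¹ l' l := by
    simp only [Matrix.mul_apply, Finset.sum_mul]
    rw [Finset.sum_comm]
  rw [h1]
  simp only [hcol, neg_mul, Finset.sum_neg_distrib]
  have h2 : ∑ l' : N.Load, (∑ l'' : N.Load, N.lapLL θs l'' l') * (N.lapLL θs)⁻¹ l' l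
      = ∑ l'' : N.Load, ((N.lapLL θs) * (N.lapLL θs)⁻¹) l'' l := by
    simp only [Matrix.mul_apply, Finset.sum_mul]
    rw [Finset.sum_comm]
  rw [h2, Matrix.mul_nonsing_inv _ hU]
  simp [Matrix.one_apply, Finset.sum_ite_eq']

/-- `L_LL(θ) G(θ) = −L_LI(θ)` when `L_LL(θ)` is invertible. [cite: SimpsonporcoDorflerBullo2013, §3 proof of Theorem 2 (b)] -/
theorem lapLL_mul_elim {θ : Fin n → ℝ} (hU : IsUnit (N.lapLL θ).det) :
    N.lapLL θ * N.elim θ = -N.lapLI θ := by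
  rw [elim, Matrix.mul_neg, ← Matrix.mul_assoc, Matrix.mul_nonsing_inv _ hU, Matrix.one_mul]

/-! ## §3 The extension field: symmetry, conserved quantity, rest point, linearisation -/

/-- Rotational symmetry of the extension field. [cite: SimpsonporcoDorflerBullo2013, §3 proof of Theorem 2 («rotational invariance»)] -/
theorem kronField_add_const (θs θ : Fin n → ℝ) (c : ℝ) :
    N.kronField θs (fun j => θ j + c) = N.kronField θs θ := by
  have hI : N.kronFieldI θs (fun j => θ j + c) = N.kronFieldI θs θ := by
    funext i; simp only [kronFieldI, mismatch_add_const]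
  have hL : N.kronFieldL θs (fun j => θ j + c) = N.kronFieldL θs θ := by
    simp only [kronFieldL, hI, mismatch_add_const, elim, lapLL_add_const, lapLI_add_const]
  funext j
  simp only [kronField, hI, hL]

/-- **The conserved quantity `Σ_{i∈V_I} D_iθ_i`**: `Σ_i D_i F_i(θ) = 0` identically (load nodes
carry `D_l = 0`; on the inverters `Σ_I m_i − Σ_L (𝟙_IᵀL_IL L_LL⁻¹ m_L) = Σ_I m_i + Σ_L m_l = 0`).
[cite: SimpsonporcoDorflerBullo2013, §3 proof of Theorem 2 («Summing over all equations»)] -/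
theorem dc_dotProduct_kronField (hY : ∀ i j, N.Yabs i j = N.Yabs j i) (hD : ∀ i, 0 ≤ N.Dc i)
    (hDs : ∑ i, N.Dc i ≠ 0) {θs : Fin n → ℝ} (hU : IsUnit (N.lapLL θs).det) (θ : Fin n → ℝ) :
    N.Dc ⬝ᵥ N.kronField θs θ = 0 := by
  classical
  rw [dotProduct, sum_split (N := N)]
  have hl : ∀ l : N.Load, N.Dc l.1 * N.kronField θs θ l.1 = 0 := fun l => by
    rw [dc_load hD l, zero_mul]
  have hi : ∀ i : N.Inv, N.Dc i.1 * N.kronField θs θ i.1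
      = N.mismatch θ i.1 - ∑ l : N.Load, (N.lapIL θs * (N.lapLL θs)⁻¹) i l * N.mismatch θ l.1 := by
    intro i
    simp only [kronField, dif_pos i.2, kronFieldI, Matrix.mulVec, dotProduct]
    rw [mul_div_cancel₀ _ i.2.ne']
  simp only [hl, Finset.sum_const_zero, add_zero, hi, Finset.sum_sub_distrib]
  rw [Finset.sum_comm]
  simp only [← Finset.sum_mul, sum_lapIL_mul_inv hY hU, neg_one_mul, Finset.sum_neg_distrib,
    sub_neg_eq_add]
  rw [← sum_split (N := N)]
  exact sum_mismatch_eq_zero hY hDs θ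

/-- At an (Aux)-equilibrium the extension field vanishes. [cite: SimpsonporcoDorflerBullo2013, §3 proof of Theorem 2, eq. (Aux)] -/
theorem kronField_equilibrium {θs : Fin n → ℝ} (hθs : N.IsAuxEquilibrium θs) (θr : Fin n → ℝ) :
    N.kronField θr θs = 0 := by
  have hm := mismatch_eq_zero_of_isAuxEquilibrium hθs
  have hI : N.kronFieldI θr θs = 0 := by
    funext i
    simp only [kronFieldI, hm, Pi.zero_apply, zero_sub]
    simp [Matrix.mulVec, dotProduct]
  funext j
  by_cases hj : 0 < N.Dc j
  · simp only [kronField, dif_pos hj, hI, Pi.zero_apply]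
  · simp only [kronField, dif_neg hj, kronFieldL, hI, Matrix.mulVec_zero, zero_add, Pi.zero_apply]
    simp [Matrix.mulVec, dotProduct, hm]

/-- Row lemma, inverter rows of the Jacobian. [folklore] -/
private theorem kronJac_mulVec_inv (θs : Fin n → ℝ) (h : Fin n → ℝ) (i : N.Inv) :
    (N.kronJac θs *ᵥ h) i.1 = (N.kronJacI θs *ᵥ h) i := by
  simp only [Matrix.mulVec, dotProduct, kronJac, dif_pos i.2]

/-- Row lemma, load rows of the Jacobian. [folklore] -/
private theorem kronJac_mulVec_load (θs : Fin n → ℝ) (h : Fin n → ℝ) (l : N.Load) :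
    (N.kronJac θs *ᵥ h) l.1 = (N.kronJacL θs *ᵥ h) l := by
  simp only [Matrix.mulVec, dotProduct, kronJac, dif_neg l.2]

/-- `(J_I h)_i = −((L h)_i − Σ_l (L_IL L_LL⁻¹)_{il} (L h)_l)/D_i`. [folklore] -/
private theorem kronJacI_mulVec (θs : Fin n → ℝ) (h : Fin n → ℝ) (i : N.Inv) :
    (N.kronJacI θs *ᵥ h) i = -(N.Dc i.1)⁻¹ * ((N.lap θs *ᵥ h) i.1
      - ∑ l : N.Load, (N.lapIL θs * (N.lapLL θs)⁻¹) i l * (N.lap θs *ᵥ h) l.1) := by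
  rw [kronJacI, ← Matrix.mulVec_mulVec, Matrix.mulVec_diagonal, Matrix.sub_mulVec,
    ← Matrix.mulVec_mulVec]
  simp only [Pi.sub_apply]
  rfl

/-- `(J_L h)_l = (G(θ*) (J_I h))_l − (L_LL⁻¹ (L h)_L)_l`. [folklore] -/
private theorem kronJacL_mulVec (θs : Fin n → ℝ) (h : Fin n → ℝ) (l : N.Load) :
    (N.kronJacL θs *ᵥ h) l = (N.elim θs *ᵥ (N.kronJacI θs *ᵥ h)) l
      - ((N.lapLL θs)⁻¹ *ᵥ fun l' : N.Load => (N.lap θs *ᵥ h) l'.1) l := by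
  rw [kronJacL, Matrix.sub_mulVec, ← Matrix.mulVec_mulVec, ← Matrix.mulVec_mulVec]
  rfl

/-- A product `g·f` at a zero of `f` is differentiable with derivative `g(x₀)·f'` as soon as `g` is
continuous at `x₀` (no differentiability of `g` needed). [folklore] -/
private theorem hasFDerivAt_mul_of_eq_zero {E : Type*} [NormedAddCommGroup E] [NormedSpace ℝ E]
    {g f : E → ℝ} {f' : E →L[ℝ] ℝ} {x₀ : E} (hg : ContinuousAt g x₀) (hf : HasFDerivAt f f' x₀)
    (hf0 : f x₀ = 0) : HasFDerivAt (fun x => g x * f x) (g x₀ • f') x₀ := by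
  have hf' := hf
  rw [hasFDerivAt_iff_isLittleO] at hf ⊢
  have h1 : (fun x => g x - g x₀) =o[𝓝 x₀] (fun _ => (1 : ℝ)) := by
    rw [Asymptotics.isLittleO_one_iff]
    have : Tendsto (fun x => g x - g x₀) (𝓝 x₀) (𝓝 (g x₀ - g x₀)) := hg.tendsto.sub_const (g x₀)
    rwa [sub_self] at this
  have h2 : (fun x => f x) =O[𝓝 x₀] (fun x => ‖x - x₀‖) := by
    have := hf'.isBigO_sub
    simp only [hf0, sub_zero] at this
    exact this.norm_right
  have h3 : (fun x => (g x - g x₀) * f x) =o[𝓝 x₀] (fun x => x - x₀) := by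
    have := h1.mul_isBigO h2
    simp only [one_mul] at this
    exact this.of_norm_right
  have h4 : (fun x => g x₀ * (f x - f x₀ - f' (x - x₀))) =o[𝓝 x₀] (fun x => x - x₀) :=
    hf.const_mul_left (g x₀)
  refine (h3.add h4).congr_left fun x => ?_
  simp only [hf0, mul_zero, smul_apply, smul_eq_mul]
  ring

/-- `θ ↦ L_LL(θ)` is continuous. [folklore] -/
private theorem continuous_lapLL : Continuous fun θ : Fin n → ℝ => N.lapLL θ := by
  refine continuous_pi fun a => continuous_pi fun b => ?_
  simp only [lapLL, lap, linWeight]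
  by_cases hab : a.1 = b.1
  · simp only [hab, if_true]; fun_prop
  · simp only [hab, if_false]; fun_prop

/-- `θ ↦ L_LI(θ)` is continuous. [folklore] -/
private theorem continuous_lapLI : Continuous fun θ : Fin n → ℝ => N.lapLI θ := by
  refine continuous_pi fun a => continuous_pi fun b => ?_
  simp only [lapLI, lap, linWeight]
  by_cases hab : a.1 = b.1
  · simp only [hab, if_true]; fun_prop
  · simp only [hab, if_false]; fun_prop

/-- The elimination matrix `G(θ)` is continuous at a regular point (`L_LL(θ*)` invertible).
[cite: SimpsonporcoDorflerBullo2013, §3 proof of Theorem 2 (b) («`θ*` is a regular equilibrium point»)] -/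
theorem continuousAt_elim {θs : Fin n → ℝ} (hU : IsUnit (N.lapLL θs).det) (l : N.Load) (i : N.Inv) :
    ContinuousAt (fun θ => N.elim θ l i) θs := by
  have hdet : Continuous fun θ : Fin n → ℝ => (N.lapLL θ).det := continuous_lapLL.matrix_det
  have hadj : Continuous fun θ : Fin n → ℝ => (N.lapLL θ).adjugate := continuous_lapLL.matrix_adjugate
  have hinv : ∀ l l' : N.Load, ContinuousAt (fun θ => (N.lapLL θ)⁻¹ l l') θs := by
    intro l l'
    have hform : (fun θ => (N.lapLL θ)⁻¹ l l')
        = fun θ => ((N.lapLL θ).det)⁻¹ * (N.lapLL θ).adjugate l l' := by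
      funext θ
      rw [Matrix.inv_def, Ring.inverse_eq_inv]
      rfl
    rw [hform]
    exact ((hdet.continuousAt).inv₀ hU.ne_zero).mul (hadj.matrix_elem l l').continuousAt
  have hform : (fun θ => N.elim θ l i) = fun θ => -∑ l', (N.lapLL θ)⁻¹ l l' * N.lapLI θ l' i := by
    funext θ; simp [elim, Matrix.mul_apply]
  rw [hform]
  refine ContinuousAt.neg (tendsto_finsetSum _ fun l' _ => ?_)
  exact (hinv l l').mul (continuous_lapLI.matrix_elem l' i).continuousAt

/-- **The linearisation of the extension field at `θ*` IS `kronJac θ*`** (`L_LL(θ*)` invertible):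
Fréchet derivative `toLin' (kronJac θ*)` at `θ*`.
[cite: SimpsonporcoDorflerBullo2013, §3 proof of Theorem 2 (b) («we obtain
`d(Δθ_I)/dt = −D_I⁻¹L_red(θ*)Δθ_I`»)] -/
theorem hasFDerivAt_kronField {θs : Fin n → ℝ} (hθs : N.IsAuxEquilibrium θs)
    (hU : IsUnit (N.lapLL θs).det) :
    HasFDerivAt (N.kronField θs) (LinearMap.toContinuousLinearMap (Matrix.toLin' (N.kronJac θs)))
      θs := by
  -- the mismatch derivatives
  set M : Fin n → (Fin n → ℝ) →L[ℝ] ℝ := fun i =>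
    -(∑ j, N.linWeight θs i j •
      ((ContinuousLinearMap.proj i : (Fin n → ℝ) →L[ℝ] ℝ) - ContinuousLinearMap.proj j)) with hMdef
  have hM : ∀ i, HasFDerivAt (fun θ => N.mismatch θ i) (M i) θs := fun i => hasFDerivAt_mismatch θs i
  have hMapp : ∀ i h, M i h = -((N.lap θs *ᵥ h) i) := fun i h => mismatchDeriv_apply θs i h
  set C : Matrix N.Inv N.Load ℝ := N.lapIL θs * (N.lapLL θs)⁻¹ with hCdef
  -- inverter rows
  have hI : ∀ i : N.Inv, HasFDerivAt (fun θ => N.kronFieldI θs θ i)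
      ((N.Dc i.1)⁻¹ • (M i.1 - ∑ l : N.Load, C i l • M l.1)) θs := by
    intro i
    have h1 := ((hM i.1).sub (HasFDerivAt.fun_sum (u := Finset.univ)
      fun (l : N.Load) _ => (hM l.1).const_mul (C i l))).const_mul (N.Dc i.1)⁻¹
    refine (h1.congr_of_eventuallyEq (Eventually.of_forall fun θ => ?_)).congr_fderiv ?_
    · simp only [kronFieldI, Matrix.mulVec, dotProduct, hCdef, div_eq_inv_mul, Pi.sub_apply]
    · ext h
      simp only [smul_apply, sub_apply, _root_.sum_apply,
        smul_eq_mul]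
  have hIapp : ∀ (i : N.Inv) (h : Fin n → ℝ),
      ((N.Dc i.1)⁻¹ • (M i.1 - ∑ l : N.Load, C i l • M l.1)) h = (N.kronJacI θs *ᵥ h) i := by
    intro i h
    rw [kronJacI_mulVec]
    simp only [smul_apply, sub_apply, _root_.sum_apply, smul_eq_mul, hMapp, hCdef, mul_neg,
      Finset.sum_neg_distrib]
    ring
  have hI0 : ∀ i : N.Inv, N.kronFieldI θs θs i = 0 := fun i => by
    have := kronField_equilibrium hθs θs
    have h := congrFun this i.1
    simp only [kronField, dif_pos i.2, Pi.zero_apply] at h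
    exact h
  rw [hasFDerivAt_pi']
  intro j
  by_cases hj : 0 < N.Dc j
  · -- inverter row
    have hfun : (fun θ => N.kronField θs θ j) = fun θ => N.kronFieldI θs θ ⟨j, hj⟩ := by
      funext θ; simp only [kronField, dif_pos hj]
    rw [hfun]
    refine (hI ⟨j, hj⟩).congr_fderiv (ContinuousLinearMap.ext fun h => ?_)
    rw [hIapp, ContinuousLinearMap.comp_apply, LinearMap.coe_toContinuousLinearMap',
      Matrix.toLin'_apply, ContinuousLinearMap.proj_apply]
    exact (kronJac_mulVec_inv θs h ⟨j, hj⟩).symm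
  · -- load row: `Σ_i G(θ)_{li} F_i(θ) + Σ_l' (L_LL⁻¹)_{ll'} m_l'(θ)`
    set l : N.Load := ⟨j, hj⟩ with hl
    have hfun : (fun θ => N.kronField θs θ j)
        = fun θ => (∑ i : N.Inv, N.elim θ l i * N.kronFieldI θs θ i)
            + ∑ l' : N.Load, (N.lapLL θs)⁻¹ l l' * N.mismatch θ l'.1 := by
      funext θ
      simp only [kronField, dif_neg hj, kronFieldL, Pi.add_apply, Matrix.mulVec, dotProduct, hl]
    rw [hfun]
    have hprod : ∀ i : N.Inv, HasFDerivAt (fun θ => N.elim θ l i * N.kronFieldI θs θ i)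
        (N.elim θs l i • ((N.Dc i.1)⁻¹ • (M i.1 - ∑ l' : N.Load, C i l' • M l'.1))) θs :=
      fun i => hasFDerivAt_mul_of_eq_zero (continuousAt_elim hU l i) (hI i) (hI0 i)
    have h1 := (HasFDerivAt.fun_sum (u := Finset.univ) fun (i : N.Inv) _ => hprod i).add
      (HasFDerivAt.fun_sum (u := Finset.univ)
        fun (l' : N.Load) _ => (hM l'.1).const_mul ((N.lapLL θs)⁻¹ l l'))
    refine h1.congr_fderiv (ContinuousLinearMap.ext fun h => ?_)
    rw [ContinuousLinearMap.comp_apply, LinearMap.coe_toContinuousLinearMap', Matrix.toLin'_apply,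
      ContinuousLinearMap.proj_apply]
    have hrow : (N.kronJac θs *ᵥ h) j = (N.kronJacL θs *ᵥ h) l := kronJac_mulVec_load θs h l
    rw [hrow, kronJacL_mulVec]
    simp only [add_apply, _root_.sum_apply, smul_apply,
      smul_eq_mul, hIapp, hMapp, Matrix.mulVec, dotProduct]
    simp only [mul_neg, Finset.sum_neg_distrib, sub_eq_add_neg]

/-! ## §4 The spectrum of `kronJac θ*`: left half-plane except the rotation mode -/

/-- Entries of the inverter rows of the Jacobian. [folklore] -/
private theorem kronJacI_apply (θs : Fin n → ℝ) (i : N.Inv) (j : Fin n) :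
    N.kronJacI θs i j = -(N.Dc i.1)⁻¹ * (N.lap θs i.1 j
      - ∑ l : N.Load, (N.lapIL θs * (N.lapLL θs)⁻¹) i l * N.lap θs l.1 j) := by
  rw [kronJacI, Matrix.diagonal_mul]
  simp only [Matrix.sub_apply, Matrix.mul_apply, lapI, lapL]

/-- Entries of the load rows of the Jacobian. [folklore] -/
private theorem kronJacL_apply (θs : Fin n → ℝ) (l : N.Load) (j : Fin n) :
    N.kronJacL θs l j = ∑ i : N.Inv, N.elim θs l i * N.kronJacI θs i j
      - ∑ l' : N.Load, (N.lapLL θs)⁻¹ l l' * N.lap θs l'.1 j := by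
  simp only [kronJacL, Matrix.sub_apply, Matrix.mul_apply, lapL]

/-- A row identity used to complexify the inverter rows. [folklore] -/
private theorem sum_row_identity {ι κ R : Type*} [Fintype ι] [Fintype κ] [CommRing R]
    (c : R) (a v : ι → R) (C : κ → R) (b : κ → ι → R) :
    ∑ x, (c * (a x - ∑ l, C l * b l x)) * v x
      = c * (∑ x, a x * v x - ∑ l, C l * ∑ x, b l x * v x) := by
  simp only [sub_mul, mul_sub, Finset.sum_sub_distrib, Finset.mul_sum, Finset.sum_mul]
  congr 1
  · exact Finset.sum_congr rfl fun x _ => by ring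
  · rw [Finset.sum_comm]
    exact Finset.sum_congr rfl fun l _ => Finset.sum_congr rfl fun x _ => by ring

/-- Inverter row of the complexified Jacobian: `−D_i⁻¹((Lv)_i − Σ_l (L_IL L_LL⁻¹)_{il}(Lv)_l)`. [folklore] -/
private theorem kronJac_map_mulVec_inv (θs : Fin n → ℝ) (v : Fin n → ℂ) (i : N.Inv) :
    (((N.kronJac θs).map ((↑) : ℝ → ℂ)) *ᵥ v) i.1
      = -((N.Dc i.1 : ℝ) : ℂ)⁻¹ * ((((N.lap θs).map ((↑) : ℝ → ℂ)) *ᵥ v) i.1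
        - ∑ l : N.Load, ((N.lapIL θs * (N.lapLL θs)⁻¹) i l : ℂ)
          * (((N.lap θs).map ((↑) : ℝ → ℂ)) *ᵥ v) l.1) := by
  simp only [Matrix.mulVec, dotProduct, Matrix.map_apply, kronJac, dif_pos i.2, Subtype.coe_eta,
    kronJacI_apply]
  push_cast
  exact sum_row_identity _ _ _ _ _

/-- Load row of the complexified Jacobian: `Σ_i G_{li}(Jv)_i − Σ_l' (L_LL⁻¹)_{ll'}(Lv)_l'`. [folklore] -/
private theorem kronJac_map_mulVec_load (θs : Fin n → ℝ) (v : Fin n → ℂ) (l : N.Load) :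
    (((N.kronJac θs).map ((↑) : ℝ → ℂ)) *ᵥ v) l.1
      = ∑ i : N.Inv, (N.elim θs l i : ℂ) * (((N.kronJac θs).map ((↑) : ℝ → ℂ)) *ᵥ v) i.1
        - ∑ l' : N.Load, ((N.lapLL θs)⁻¹ l l' : ℂ) * (((N.lap θs).map ((↑) : ℝ → ℂ)) *ᵥ v) l'.1 := by
  have hi : ∀ i : N.Inv, (((N.kronJac θs).map ((↑) : ℝ → ℂ)) *ᵥ v) i.1
      = ∑ j, (N.kronJacI θs i j : ℂ) * v j := fun i => by
    simp only [Matrix.mulVec, dotProduct, Matrix.map_apply, kronJac, dif_pos i.2, Subtype.coe_eta]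
  simp only [hi]
  simp only [Matrix.mulVec, dotProduct, Matrix.map_apply, kronJac, dif_neg l.2, kronJacL_apply]
  push_cast
  simp only [sub_mul, Finset.sum_sub_distrib, Finset.sum_mul, Finset.mul_sum]
  congr 1
  · rw [Finset.sum_comm]
    exact Finset.sum_congr rfl fun i _ => Finset.sum_congr rfl fun j _ => by ring
  · rw [Finset.sum_comm]
    exact Finset.sum_congr rfl fun l' _ => Finset.sum_congr rfl fun j _ => by ring

/-- The complexified Laplacian row: `(L v)_j = Σ_j' c_jj' (v_j − v_j')`. [folklore] -/
private theorem lap_map_mulVec_eq (θs : Fin n → ℝ) (v : Fin n → ℂ) (j : Fin n) :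
    (((N.lap θs).map ((↑) : ℝ → ℂ)) *ᵥ v) j = ∑ j', (N.linWeight θs j j' : ℂ) * (v j - v j') := by
  have hentry : ∀ j', ((N.lap θs).map ((↑) : ℝ → ℂ)) j j'
      = (if j = j' then ∑ k, (N.linWeight θs j k : ℂ) else 0) - (N.linWeight θs j j' : ℂ) := by
    intro j'
    simp only [Matrix.map_apply, lap]
    split_ifs <;> push_cast <;> ring
  simp only [Matrix.mulVec, dotProduct, hentry, sub_mul, Finset.sum_sub_distrib, ite_mul, zero_mul,
    Finset.sum_ite_eq, Finset.mem_univ, if_true, mul_sub, Finset.sum_mul]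

/-- The load part of `Lv` through the blocks: `(Lv)_l = Σ_l' L_LL,ll' v_l' + Σ_i L_LI,li v_i`. [folklore] -/
private theorem lap_map_mulVec_load (θs : Fin n → ℝ) (v : Fin n → ℂ) (l : N.Load) :
    (((N.lap θs).map ((↑) : ℝ → ℂ)) *ᵥ v) l.1
      = ∑ l' : N.Load, (N.lapLL θs l l' : ℂ) * v l'.1 + ∑ i : N.Inv, (N.lapLI θs l i : ℂ) * v i.1 := by
  simp only [Matrix.mulVec, dotProduct, Matrix.map_apply, lapLL, lapLI]
  rw [sum_split (N := N), add_comm]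

/-- The Laplacian form over `ℂ`: `2 Σ_i conj(v_i) Σ_j c_ij (v_i − v_j) = Σ_i Σ_j c_ij |v_i − v_j|²`
(symmetric `c`). [folklore] -/
private theorem conj_lapForm_eq' {c : Fin n → Fin n → ℝ} (hc : ∀ i j, c i j = c j i) (v : Fin n → ℂ) :
    2 * ∑ i, conj (v i) * ∑ j, (c i j : ℂ) * (v i - v j)
      = ((∑ i, ∑ j, c i j * ‖v i - v j‖ ^ 2 : ℝ) : ℂ) := by
  have hS : ∑ i, conj (v i) * ∑ j, (c i j : ℂ) * (v i - v j)
      = ∑ i, ∑ j, (c i j : ℂ) * (conj (v i) * (v i - v j)) := by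
    refine Finset.sum_congr rfl fun i _ => ?_
    rw [Finset.mul_sum]
    refine Finset.sum_congr rfl fun j _ => ?_
    ring
  have hS' : ∑ i, ∑ j, (c i j : ℂ) * (conj (v i) * (v i - v j))
      = ∑ i, ∑ j, (c i j : ℂ) * (conj (v j) * (v j - v i)) := by
    rw [Finset.sum_comm]
    refine Finset.sum_congr rfl fun i _ => Finset.sum_congr rfl fun j _ => ?_
    rw [hc j i]
  rw [two_mul, hS]
  conv_lhs => arg 2; rw [hS']
  push_cast
  rw [← Finset.sum_add_distrib]
  refine Finset.sum_congr rfl fun i _ => ?_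
  rw [← Finset.sum_add_distrib]
  refine Finset.sum_congr rfl fun j _ => ?_
  rw [← Complex.conj_mul' (v i - v j), map_sub]
  ring

/-- A complex Laplacian form with a real PSD + kernel certificate is a nonnegative real, and it
vanishes only on constant vectors. [folklore] -/
private theorem lapForm_real_of_psd' {c : Fin n → Fin n → ℝ} (hc : ∀ i j, c i j = c j i)
    (hpsd : ∀ u : Fin n → ℝ, 0 ≤ ∑ i, u i * ∑ j, c i j * (u i - u j))
    (hker : ∀ u : Fin n → ℝ, ∑ i, u i * ∑ j, c i j * (u i - u j) = 0 → ∃ a : ℝ, u = fun _ => a)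
    (v : Fin n → ℂ) :
    ∃ r : ℝ, 0 ≤ r ∧ (∑ i, conj (v i) * ∑ j, (c i j : ℂ) * (v i - v j)) = (r : ℂ) ∧
      (r = 0 → ∃ a : ℂ, v = fun _ => a) := by
  obtain ⟨R, hR⟩ : ∃ R : ℂ, R = ∑ i, conj (v i) * ∑ j, (c i j : ℂ) * (v i - v j) := ⟨_, rfl⟩
  obtain ⟨Q, hQ⟩ : ∃ Q : ℝ, Q = ∑ i, ∑ j, c i j * ‖v i - v j‖ ^ 2 := ⟨_, rfl⟩
  obtain ⟨fr, hfr⟩ : ∃ fr : ℝ, fr = ∑ i, (v i).re * ∑ j, c i j * ((v i).re - (v j).re) := ⟨_, rfl⟩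
  obtain ⟨fi, hfi⟩ : ∃ fi : ℝ, fi = ∑ i, (v i).im * ∑ j, c i j * ((v i).im - (v j).im) := ⟨_, rfl⟩
  have hRQ : 2 * R = (Q : ℂ) := by rw [hR, hQ]; exact conj_lapForm_eq' hc v
  have hRre : R.re = fr + fi := by rw [hR, hfr, hfi]; exact re_conj_lapForm c v
  have hRim : R.im = 0 := by
    have h := congrArg Complex.im hRQ
    simp only [Complex.mul_im, Complex.ofReal_im] at h
    norm_num at h
    exact h
  have hfr0 : 0 ≤ fr := by rw [hfr]; exact hpsd _
  have hfi0 : 0 ≤ fi := by rw [hfi]; exact hpsd _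
  refine ⟨fr + fi, by positivity, ?_, fun h0 => ?_⟩
  · rw [← hR]
    exact Complex.ext (by simp [hRre]) (by simp [hRim])
  · have hfr00 : fr = 0 := by linarith
    have hfi00 : fi = 0 := by linarith
    obtain ⟨ar, har⟩ := hker _ (hfr ▸ hfr00)
    obtain ⟨ai, hai⟩ := hker _ (hfi ▸ hfi00)
    refine ⟨⟨ar, ai⟩, funext fun i => Complex.ext ?_ ?_⟩
    · simpa using congrFun har i
    · simpa using congrFun hai i

/-- **The spectral sentence of the Kron-reduced linearisation, PROVED**: `D_i > 0` on `V_I`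
(`D_i ≥ 0` everywhere), `|Y|` symmetric, an angle vector `θ*` whose real Hessian form
`u ↦ Σ_i u_i Σ_j a_ij cos(θ*_i − θ*_j)(u_i − u_j)` is `≥ 0` with kernel the constants (the arc case
included), at least one inverter.  Then every complex eigenpair `(μ, v)` of `kronJac θ*` has
`Re μ < 0` (it is `−1` off the linearised constraint `Δθ_L = G(θ*)Δθ_I`, and an eigenvalue of
`−D_I⁻¹L_red(θ*)` on it) or `μ = 0` with `v ∈ ℂ𝟙` — «`L_red(θ*)` is also a Laplacian matrix».
[cite: SimpsonporcoDorflerBullo2013, §3 proof of Theorem 2 (b) (held text p0008 L41–L49)] -/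
theorem kronJac_eig_re_neg_or_rotation (hY : ∀ i j, N.Yabs i j = N.Yabs j i) {θs : Fin n → ℝ}
    (hpsd : ∀ u : Fin n → ℝ, 0 ≤ ∑ i, u i * ∑ j, N.linWeight θs i j * (u i - u j))
    (hker : ∀ u : Fin n → ℝ, ∑ i, u i * ∑ j, N.linWeight θs i j * (u i - u j) = 0 →
      ∃ a : ℝ, u = fun _ => a)
    (i₀ : N.Inv) {μ : ℂ} {v : Fin n → ℂ} (hv : v ≠ 0)
    (hJ : (N.kronJac θs).map ((↑) : ℝ → ℂ) *ᵥ v = μ • v) :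
    μ.re < 0 ∨ (μ = 0 ∧ ∃ a : ℂ, v = fun i => a * ((fun _ : Fin n => (1 : ℝ)) i : ℂ)) := by
  classical
  have hU : IsUnit (N.lapLL θs).det := isUnit_lapLL_det hker i₀
  have hc : ∀ i j, N.linWeight θs i j = N.linWeight θs j i := linWeight_symm hY θs
  -- abbreviations: `u = L v`, `G`, `w = G v_I`, `y = v_L − w`
  set u : Fin n → ℂ := ((N.lap θs).map ((↑) : ℝ → ℂ)) *ᵥ v with hu
  set G : Matrix N.Load N.Inv ℝ := N.elim θs with hG
  set w : N.Load → ℂ := fun l => ∑ i : N.Inv, (G l i : ℂ) * v i.1 with hw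
  set y : N.Load → ℂ := fun l => v l.1 - w l with hy
  -- complexified block identities
  have hLG : ∀ (l : N.Load) (i : N.Inv),
      (N.lapLI θs l i : ℂ) = -∑ l' : N.Load, (N.lapLL θs l l' : ℂ) * (G l' i : ℂ) := by
    intro l i
    have h := congrFun (congrFun (lapLL_mul_elim (N := N) hU) l) i
    simp only [Matrix.mul_apply, Matrix.neg_apply] at h
    have h' : N.lapLI θs l i = -∑ l', N.lapLL θs l l' * N.elim θs l' i := by linarith
    rw [h', hG]; push_cast; rfl
  have hinvL : ∀ l l'' : N.Load,
      ∑ l' : N.Load, ((N.lapLL θs)⁻¹ l l' : ℂ) * (N.lapLL θs l' l'' : ℂ) = if l = l'' then 1 else 0 := by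
    intro l l''
    have h := congrFun (congrFun (Matrix.nonsing_inv_mul _ hU) l) l''
    simp only [Matrix.mul_apply, Matrix.one_apply] at h
    have h' : ((∑ l', (N.lapLL θs)⁻¹ l l' * N.lapLL θs l' l'' : ℝ) : ℂ)
        = ((if l = l'' then 1 else 0 : ℝ) : ℂ) := by rw [h]
    push_cast at h'
    rw [h']
    split_ifs <;> simp
  -- (K1) `u_l = Σ_l' L_LL,ll' y_l'`
  have hK1 : ∀ l : N.Load, u l.1 = ∑ l' : N.Load, (N.lapLL θs l l' : ℂ) * y l' := by
    intro l
    rw [hu, lap_map_mulVec_load]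
    simp only [hy, hw, mul_sub, Finset.sum_sub_distrib, hLG, neg_mul, Finset.sum_neg_distrib]
    rw [← sub_eq_add_neg]
    congr 1
    simp only [Finset.sum_mul, Finset.mul_sum]
    rw [Finset.sum_comm]
    exact Finset.sum_congr rfl fun _ _ => Finset.sum_congr rfl fun _ _ => by ring
  -- (K2) `Σ_l' (L_LL⁻¹)_ll' u_l' = y_l`
  have hK2 : ∀ l : N.Load, ∑ l' : N.Load, ((N.lapLL θs)⁻¹ l l' : ℂ) * u l'.1 = y l := by
    intro l
    simp only [hK1, Finset.mul_sum]
    rw [Finset.sum_comm]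
    have : ∀ l'' : N.Load, ∑ l', ((N.lapLL θs)⁻¹ l l' : ℂ) * ((N.lapLL θs l' l'' : ℂ) * y l'')
        = (if l = l'' then 1 else 0) * y l'' := by
      intro l''
      rw [← hinvL l l'', Finset.sum_mul]
      exact Finset.sum_congr rfl fun l' _ => by ring
    simp only [this, ite_mul, one_mul, zero_mul, Finset.sum_ite_eq, Finset.mem_univ, if_true]
  -- the load rows of the eigen-equation: `(1 + μ) y_l = 0`
  have hEi : ∀ i : N.Inv, (((N.kronJac θs).map ((↑) : ℝ → ℂ)) *ᵥ v) i.1 = μ * v i.1 := fun i => by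
    have := congrFun hJ i.1
    simpa using this
  have hyμ : ∀ l : N.Load, (1 + μ) * y l = 0 := by
    intro l
    have h := congrFun hJ l.1
    rw [kronJac_map_mulVec_load] at h
    rw [← hu] at h
    simp only [Pi.smul_apply, smul_eq_mul, hEi, hK2] at h
    -- `h : Σ_i G_li (μ v_i) − y_l = μ v_l`
    have hGμ : ∑ i : N.Inv, (G l i : ℂ) * (μ * v i.1) = μ * w l := by
      simp only [hw, Finset.mul_sum]
      exact Finset.sum_congr rfl fun i _ => by ring
    rw [hG] at hGμ
    rw [hGμ] at h
    simp only [hy]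
    linear_combination -h
  by_cases hyz : ∃ l : N.Load, y l ≠ 0
  · -- off the linearised constraint: `μ = −1`
    obtain ⟨l, hl⟩ := hyz
    have : 1 + μ = 0 := (mul_eq_zero.1 (hyμ l)).resolve_right hl
    left
    have hμ : μ = -1 := by linear_combination this
    rw [hμ]; norm_num
  · push Not at hyz
    -- on the constraint: `u_L = 0`, the inverter rows read `u_i = −μ D_i v_i`
    have huL : ∀ l : N.Load, u l.1 = 0 := fun l => by
      rw [hK1 l]; exact Finset.sum_eq_zero fun l' _ => by rw [hyz l', mul_zero]
    have hDC : ∀ i : N.Inv, ((N.Dc i.1 : ℝ) : ℂ) ≠ 0 := fun i => by exact_mod_cast i.2.ne'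
    have huI : ∀ i : N.Inv, u i.1 = -μ * (N.Dc i.1 : ℂ) * v i.1 := by
      intro i
      have h := hEi i
      rw [kronJac_map_mulVec_inv] at h
      rw [← hu] at h
      simp only [huL, mul_zero, Finset.sum_const_zero, sub_zero] at h
      have h2 : u i.1 / (N.Dc i.1 : ℂ) = -(μ * v i.1) := by
        rw [div_eq_mul_inv]; linear_combination -h
      rw [div_eq_iff (hDC i)] at h2
      linear_combination h2
    -- the full form
    obtain ⟨r, hr0, hR, hrker⟩ := lapForm_real_of_psd' hc hpsd hker v
    obtain ⟨NI, hNI⟩ : ∃ NI : ℝ, NI = ∑ i : N.Inv, N.Dc i.1 * ‖v i.1‖ ^ 2 := ⟨_, rfl⟩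
    have hNI0 : 0 ≤ NI := by
      rw [hNI]; exact Finset.sum_nonneg fun i _ => mul_nonneg i.2.le (sq_nonneg _)
    have hform : (r : ℂ) = -μ * (NI : ℂ) := by
      have h1 : ∑ j, conj (v j) * u j = (r : ℂ) := by
        rw [← hR]
        refine Finset.sum_congr rfl fun j _ => ?_
        rw [hu, lap_map_mulVec_eq]
      rw [← h1, sum_split (N := N)]
      simp only [huL, mul_zero, Finset.sum_const_zero, add_zero, huI, hNI]
      push_cast
      rw [Finset.mul_sum]
      refine Finset.sum_congr rfl fun i _ => ?_
      rw [← Complex.conj_mul' (v i.1)]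
      ring
    rcases hNI0.lt_or_eq with hNIpos | hNI00
    · -- `μ = −r/N_I` real, `≤ 0`; `< 0` unless `r = 0`, the rotation
      have hμ : μ = ((-r / NI : ℝ) : ℂ) := by
        have hNC : ((NI : ℝ) : ℂ) ≠ 0 := by exact_mod_cast hNIpos.ne'
        push_cast
        field_simp
        linear_combination hform
      rcases hr0.lt_or_eq with hrpos | hr00
      · left
        rw [hμ, Complex.ofReal_re]
        exact div_neg_of_neg_of_pos (by linarith) hNIpos
      · right
        have hμ0 : μ = 0 := by rw [hμ, ← hr00]; simp
        obtain ⟨a, ha⟩ := hrker hr00.symm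
        exact ⟨hμ0, a, by rw [ha]; funext i; simp⟩
    · -- `N_I = 0`: `v_I = 0`, then `v_L = w = 0`: contradiction
      exfalso
      have hvI : ∀ i : N.Inv, v i.1 = 0 := by
        intro i
        have hterm : ∀ j ∈ (Finset.univ : Finset N.Inv), 0 ≤ N.Dc j.1 * ‖v j.1‖ ^ 2 :=
          fun j _ => mul_nonneg j.2.le (sq_nonneg _)
        have h0 := (Finset.sum_eq_zero_iff_of_nonneg hterm).1 (hNI ▸ hNI00.symm) i (Finset.mem_univ i)
        rcases mul_eq_zero.1 h0 with h | h
        · exact absurd h i.2.ne'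
        · exact norm_eq_zero.1 (pow_eq_zero_iff (n := 2) (by norm_num) |>.1 h)
      have hwl : ∀ l : N.Load, w l = 0 := fun l => by
        simp only [hw]; exact Finset.sum_eq_zero fun i _ => by rw [hvI i, mul_zero]
      apply hv
      funext j
      by_cases hj : 0 < N.Dc j
      · exact hvI ⟨j, hj⟩
      · have := hyz ⟨j, hj⟩
        simp only [hy, hwl, sub_zero] at this
        exact this

/-! ## §5 Local exponential stability of the extension flow (within the leaf, modulo rotation) -/

/-- **LES within the leaf `Σ_{V_I} D_iθ_i = const` for the extension flow** (Lyapunov's indirect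
method on the rotation quotient): `D_i ≥ 0`, at least one inverter, `|Y|` symmetric, an
(Aux)-equilibrium `θ*` with the PSD + kernel certificate (e.g. the arc, `posCurvature_of_arc`).
[cite: SimpsonporcoDorflerBullo2013, §3 Theorem 2 (i) and proof of (b) (held text p0008 L41–L49)] -/
theorem kron_expStable_within_leaf (hY : ∀ i j, N.Yabs i j = N.Yabs j i) (hD : ∀ i, 0 ≤ N.Dc i)
    (i₀ : N.Inv) {θs : Fin n → ℝ} (hθs : N.IsAuxEquilibrium θs)
    (hpsd : ∀ u : Fin n → ℝ, 0 ≤ ∑ i, u i * ∑ j, N.linWeight θs i j * (u i - u j))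
    (hker : ∀ u : Fin n → ℝ, ∑ i, u i * ∑ j, N.linWeight θs i j * (u i - u j) = 0 →
      ∃ a : ℝ, u = fun _ => a) :
    ∃ ρ > 0, ∃ k > 0, ∃ lam > 0, ∀ (X : ℝ → Fin n → ℝ) (T : ℝ),
      (∀ t ∈ Icc 0 T, HasDerivWithinAt X (N.kronField θs (X t)) (Icc 0 T) t) →
      N.Dc ⬝ᵥ X 0 = N.Dc ⬝ᵥ θs → ‖X 0 - θs‖ < ρ →
      ∀ t ∈ Icc 0 T, ‖X t - θs‖ ≤ k * ‖X 0 - θs‖ * Real.exp (-lam * t) := by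
  have hDs : 0 < ∑ i, N.Dc i :=
    lt_of_lt_of_le i₀.2 (Finset.single_le_sum (fun i _ => hD i) (Finset.mem_univ i₀.1))
  have hU : IsUnit (N.lapLL θs).det := isUnit_lapLL_det hker i₀
  have hlr : N.Dc ⬝ᵥ (fun _ : Fin n => (1 : ℝ)) ≠ 0 := by
    simp only [dotProduct, mul_one]; exact hDs.ne'
  exact Literature.Analysis.ODE.exists_expStable_within_of_eig_re_neg_or_smul
    (hasFDerivAt_kronField hθs hU) (kronField_equilibrium hθs θs)
    (fun x => dc_dotProduct_kronField hY hD hDs.ne' hU x) hlr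
    (fun μ v hv hJ => kronJac_eig_re_neg_or_rotation hY hpsd hker i₀ hv hJ)

/-- `|Σ D_i h_i| ≤ (Σ D_i)‖h‖` for `D ≥ 0` (sup norm). [folklore] -/
private theorem abs_dc_dotProduct_le' (hD : ∀ i, 0 ≤ N.Dc i) (h : Fin n → ℝ) :
    |N.Dc ⬝ᵥ h| ≤ (∑ i, N.Dc i) * ‖h‖ := by
  calc |N.Dc ⬝ᵥ h| = |∑ i, N.Dc i * h i| := rfl
    _ ≤ ∑ i, |N.Dc i * h i| := Finset.abs_sum_le_sum_abs _ _
    _ ≤ ∑ i, N.Dc i * ‖h‖ := Finset.sum_le_sum fun i _ => by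
        rw [abs_mul, abs_of_nonneg (hD i)]
        exact mul_le_mul_of_nonneg_left (by simpa using norm_le_pi_norm h i) (hD i)
    _ = (∑ i, N.Dc i) * ‖h‖ := by rw [Finset.sum_mul]

/-- **From the leaf to every nearby state, extension flow**: with the within-leaf estimate as
hypothesis `H`, every solution of `X' = F(X)` on `[0, T]` with `‖X(0) − θ*‖ < ρ/2` satisfies
`‖X(t) − (θ* + c𝟙)‖ ≤ k‖X(0) − (θ* + c𝟙)‖e^{−λt}`, `c = Σ_i D_i(X_i(0) − θ*_i)/Σ_i D_i`.
[cite: SimpsonporcoDorflerBullo2013, §3 Theorem 2 (i) («unique … (mod 2π)»)] -/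
theorem kron_expStable_modRotation_of_within_leaf (hD : ∀ i, 0 ≤ N.Dc i) (i₀ : N.Inv)
    {θs : Fin n → ℝ} {ρ k lam : ℝ}
    (H : ∀ (X : ℝ → Fin n → ℝ) (T : ℝ),
      (∀ t ∈ Icc 0 T, HasDerivWithinAt X (N.kronField θs (X t)) (Icc 0 T) t) →
      N.Dc ⬝ᵥ X 0 = N.Dc ⬝ᵥ θs → ‖X 0 - θs‖ < ρ →
      ∀ t ∈ Icc 0 T, ‖X t - θs‖ ≤ k * ‖X 0 - θs‖ * Real.exp (-lam * t)) :
    ∀ (X : ℝ → Fin n → ℝ) (T : ℝ),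
      (∀ t ∈ Icc 0 T, HasDerivWithinAt X (N.kronField θs (X t)) (Icc 0 T) t) → ‖X 0 - θs‖ < ρ / 2 →
      ∀ t ∈ Icc 0 T,
        ‖X t - fun i => θs i + N.Dc ⬝ᵥ (X 0 - θs) / ∑ i, N.Dc i‖
          ≤ k * ‖X 0 - fun i => θs i + N.Dc ⬝ᵥ (X 0 - θs) / ∑ i, N.Dc i‖ * Real.exp (-lam * t) := by
  intro X T hX h0 t ht
  have hDs : 0 < ∑ i, N.Dc i :=
    lt_of_lt_of_le i₀.2 (Finset.single_le_sum (fun i _ => hD i) (Finset.mem_univ i₀.1))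
  set c : ℝ := N.Dc ⬝ᵥ (X 0 - θs) / ∑ i, N.Dc i with hcdef
  set Y : ℝ → Fin n → ℝ := fun s i => X s i - c with hYdef
  have hYsol : ∀ s ∈ Icc 0 T, HasDerivWithinAt Y (N.kronField θs (Y s)) (Icc 0 T) s := by
    intro s hs
    have h1 : HasDerivWithinAt Y (N.kronField θs (X s) - 0) (Icc 0 T) s :=
      (hX s hs).sub (hasDerivWithinAt_const s (Icc 0 T) (fun _ : Fin n => c))
    have h2 : N.kronField θs (Y s) = N.kronField θs (X s) := by
      have := kronField_add_const (N := N) θs (X s) (-c)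
      simpa [hYdef, sub_eq_add_neg] using this
    rw [h2, ← sub_zero (N.kronField θs (X s))]
    exact h1
  have hYleaf : N.Dc ⬝ᵥ Y 0 = N.Dc ⬝ᵥ θs := by
    have h1 : N.Dc ⬝ᵥ Y 0 = N.Dc ⬝ᵥ X 0 - c * ∑ i, N.Dc i := by
      simp only [hYdef, dotProduct, mul_sub, Finset.sum_sub_distrib, Finset.mul_sum]
      congr 1
      refine Finset.sum_congr rfl fun i _ => ?_
      ring
    have h2 : c * ∑ i, N.Dc i = N.Dc ⬝ᵥ X 0 - N.Dc ⬝ᵥ θs := by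
      rw [hcdef, div_mul_cancel₀ _ hDs.ne', dotProduct_sub]
    rw [h1, h2]
    ring
  have hY0 : ‖Y 0 - θs‖ < ρ := by
    have hc : |c| ≤ ‖X 0 - θs‖ := by
      rw [hcdef, abs_div, abs_of_pos hDs, div_le_iff₀ hDs]
      calc |N.Dc ⬝ᵥ (X 0 - θs)| ≤ (∑ i, N.Dc i) * ‖X 0 - θs‖ := abs_dc_dotProduct_le' hD _
        _ = ‖X 0 - θs‖ * ∑ i, N.Dc i := mul_comm _ _
    have hdecomp : Y 0 - θs = (X 0 - θs) - fun _ => c := by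
      funext i; simp [hYdef]; ring
    calc ‖Y 0 - θs‖ = ‖(X 0 - θs) - fun _ => c‖ := by rw [hdecomp]
      _ ≤ ‖X 0 - θs‖ + ‖fun _ : Fin n => c‖ := norm_sub_le _ _
      _ ≤ ‖X 0 - θs‖ + |c| := by
          gcongr
          exact (pi_norm_const_le c).trans (le_of_eq (Real.norm_eq_abs c))
      _ ≤ ‖X 0 - θs‖ + ‖X 0 - θs‖ := by gcongr
      _ < ρ := by linarith
  have key := H Y T hYsol hYleaf hY0 t ht
  have hshape : ∀ s, Y s - θs = X s - fun i => θs i + c := fun s => by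
    funext i; simp [hYdef]; ring
  rw [hshape t, hshape 0] at key
  exact key

/-! ## §6 Solutions of the differential-algebraic closed loop are solutions of the extension flow
while `L_LL(θ(t))` stays invertible; the bootstrap; Theorem 2 (i) with load nodes -/

/-- **Constraint differentiation.**  Let `X` be differentiable at `t` with velocity `V`
(componentwise), satisfy the load constraints `m_l(X(s)) = 0` at all times, and the inverter
equations `Ẋ_i = m_i(X)/D_i` at `t`; if `L_LL(X(t))` is invertible then `Ẋ(t) = F(X(t))`
(`L_LL(θ)θ̇_L + L_LI(θ)θ̇_I = 0` solved for `θ̇_L`).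
[cite: SimpsonporcoDorflerBullo2013, §3 proof of Theorem 2 (b) («solving the set of `|V_L|`
algebraic equations and substituting into the dynamics»)] -/
theorem hasDerivAt_kronField_of_constraint {θs : Fin n → ℝ} {X : ℝ → Fin n → ℝ} {t : ℝ}
    {V : Fin n → ℝ} (hV : HasDerivAt X V t)
    (hI : ∀ i : N.Inv, V i.1 = N.mismatch (X t) i.1 / N.Dc i.1)
    (hL : ∀ (l : N.Load) (s : ℝ), N.mismatch (X s) l.1 = 0)
    (hU : IsUnit (N.lapLL (X t)).det) :
    HasDerivAt X (N.kronField θs (X t)) t := by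
  classical
  -- differentiate the constraints: `(L(X t) V)_l = 0`
  have hLV : ∀ l : N.Load, (N.lap (X t) *ᵥ V) l.1 = 0 := by
    intro l
    have h1 : HasDerivAt (fun s => N.mismatch (X s) l.1)
        (((-(∑ j, N.linWeight (X t) l.1 j •
          ((ContinuousLinearMap.proj l.1 : (Fin n → ℝ) →L[ℝ] ℝ) - ContinuousLinearMap.proj j)))
            : (Fin n → ℝ) →L[ℝ] ℝ) V) t :=
      (hasFDerivAt_mismatch (X t) l.1).comp_hasDerivAt t hV
    have h2 : HasDerivAt (fun s => N.mismatch (X s) l.1) 0 t := by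
      have : (fun s => N.mismatch (X s) l.1) = fun _ => 0 := funext fun s => hL l s
      rw [this]; exact hasDerivAt_const t 0
    have h3 := h1.unique h2
    rw [mismatchDeriv_apply] at h3
    linarith
  -- solve for the load velocities
  have hsplitV : ∀ l : N.Load,
      (N.lapLL (X t) *ᵥ fun l' : N.Load => V l'.1) l = -(N.lapLI (X t) *ᵥ fun i : N.Inv => V i.1) l := by
    intro l
    have h := hLV l
    simp only [Matrix.mulVec, dotProduct] at h ⊢
    rw [sum_split (N := N)] at h
    simp only [lapLL, lapLI]
    linarith
  have hVL : (fun l' : N.Load => V l'.1) = N.elim (X t) *ᵥ fun i : N.Inv => V i.1 := by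
    have h1 : N.lapLL (X t) *ᵥ (fun l' : N.Load => V l'.1)
        = -(N.lapLI (X t) *ᵥ fun i : N.Inv => V i.1) := funext hsplitV
    calc (fun l' : N.Load => V l'.1)
        = ((N.lapLL (X t))⁻¹ * N.lapLL (X t)) *ᵥ (fun l' : N.Load => V l'.1) := by
          rw [Matrix.nonsing_inv_mul _ hU, Matrix.one_mulVec]
      _ = (N.lapLL (X t))⁻¹ *ᵥ -(N.lapLI (X t) *ᵥ fun i : N.Inv => V i.1) := by
          rw [← Matrix.mulVec_mulVec, h1]
      _ = N.elim (X t) *ᵥ fun i : N.Inv => V i.1 := by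
          rw [Matrix.mulVec_neg, elim, Matrix.neg_mulVec, Matrix.mulVec_mulVec]
  -- compare with the extension field
  have hmL : (fun l : N.Load => N.mismatch (X t) l.1) = 0 := funext fun l => hL l t
  have hFI : N.kronFieldI θs (X t) = fun i : N.Inv => V i.1 := by
    funext i
    simp only [kronFieldI, hmL, Matrix.mulVec_zero, Pi.zero_apply, sub_zero, hI]
  have hF : N.kronField θs (X t) = V := by
    funext j
    by_cases hj : 0 < N.Dc j
    · simp only [kronField, dif_pos hj, hFI]
    · simp only [kronField, dif_neg hj, kronFieldL, hFI, hmL, Matrix.mulVec_zero, add_zero, ← hVL]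
  rw [hF]
  exact hV

/-- `L_LL` is invertible on a whole sup-norm ball around a regular point, uniformly under rotation.
[cite: SimpsonporcoDorflerBullo2013, §3 proof of Theorem 2 (b) («`θ*` is a regular equilibrium point»)] -/
theorem exists_ball_isUnit_lapLL {θs : Fin n → ℝ} (hU : IsUnit (N.lapLL θs).det) :
    ∃ r > 0, ∀ θ : Fin n → ℝ, ∀ c : ℝ, ‖θ - fun j => θs j + c‖ < r → IsUnit (N.lapLL θ).det := by
  have hcont : ContinuousAt (fun θ : Fin n → ℝ => (N.lapLL θ).det) θs :=
    (continuous_lapLL.matrix_det).continuousAt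
  have hne : ∀ᶠ θ in 𝓝 θs, (N.lapLL θ).det ≠ 0 := hcont.eventually_ne hU.ne_zero
  obtain ⟨r, hr, hball⟩ := Metric.eventually_nhds_iff.1 hne
  refine ⟨r, hr, fun θ c hθ => ?_⟩
  have h1 : N.lapLL θ = N.lapLL (fun j => θ j + (-c)) := (lapLL_add_const θ (-c)).symm
  rw [h1, isUnit_iff_ne_zero]
  apply hball
  rw [dist_eq_norm]
  have : (fun j => θ j + -c) - θs = θ - fun j => θs j + c := by funext j; simp; ring
  rw [this]; exact hθ

/-- **The differential-algebraic closed loop in the rotating frame.**  For a solution `θ` of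
(KuraDroop)–(PowerBal) at every time (`IsSolutionAt`, load rows algebraic) and `D ≥ 0`, the frame
curve `X(t) = θ(t) − ω_avg t 𝟙` is differentiable, its inverter components obey
`Ẋ_i = m_i(X)/D_i`, and the load constraints `m_l(X(t)) = 0` hold at all times.
[cite: SimpsonporcoDorflerBullo2013, §3 proof of Theorem 2 (eq. (Aux) «represents the dynamics … in a
reference frame rotating at `ω_avg`»)] -/
theorem frame_of_isSolutionAt (hD : ∀ i, 0 ≤ N.Dc i) {θ : ℝ → Fin n → ℝ}
    (hsol : ∀ t, N.IsSolutionAt θ t) (t : ℝ) :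
    (∃ V : Fin n → ℝ, HasDerivAt (fun s j => θ s j - N.avgFrequency * s) V t ∧
      ∀ i : N.Inv, V i.1 = N.mismatch (fun j => θ t j - N.avgFrequency * t) i.1 / N.Dc i.1) ∧
    ∀ (l : N.Load) (s : ℝ), N.mismatch (fun j => θ s j - N.avgFrequency * s) l.1 = 0 := by
  classical
  have hrot : ∀ s j, N.mismatch (fun j => θ s j - N.avgFrequency * s) j = N.mismatch (θ s) j := by
    intro s j
    have := congrFun (mismatch_add_const (N := N) (θ s) (-(N.avgFrequency * s))) j
    simpa [sub_eq_add_neg] using this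
  refine ⟨?_, fun l s => ?_⟩
  · choose w hw hDw using fun j => hsol t j
    refine ⟨fun j => w j - N.avgFrequency, ?_, fun i => ?_⟩
    · rw [hasDerivAt_pi]
      intro j
      exact (hw j).sub ((hasDerivAt_id t).const_mul N.avgFrequency |>.congr_deriv (by simp))
    · rw [hrot, mismatch, shiftedInjection]
      have hDi : N.Dc i.1 ≠ 0 := i.2.ne'
      field_simp
      have := hDw i.1
      linarith
  · rw [hrot, mismatch, shiftedInjection, dc_load hD l]
    obtain ⟨w, _, hDw⟩ := hsol s l.1
    rw [dc_load hD l, zero_mul] at hDw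
    linarith

/-- **SPDB2013 Theorem 2 (i), stability clause, WITH LOAD NODES — the synchronized solution is
locally exponentially stable (modulo the rotation).**  Network (CombinedKuraDroop): droop-controlled
inverters (`D_i > 0`) and load nodes (`D_i = 0`, algebraic power balance), at least one inverter,
`|Y|` symmetric; `θ₀` an (Aux)-equilibrium (the angle array of the synchronized solution
`t ↦ θ₀ + ω_avg t 𝟙`) at which the real Hessian form `u ↦ Σ_i u_i Σ_j a_ij cos(θ₀,i − θ₀,j)(u_i − u_j)`
is `≥ 0` with kernel the constants (e.g. the arc `θ₀ ∈ Δ_G(γ)`, `γ < π/2`, with `a ≥ 0` connected: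
`posCurvature_of_arc`).  Then there are `ρ, k, λ > 0` such that EVERY solution `θ` of the
differential-algebraic closed loop (`IsSolutionAt` at every time — inverter rows differential,
load rows algebraic) with `‖θ(0) − θ₀‖ < ρ` satisfies, for all `t ≥ 0`,
`‖θ(t) − (θ₀ + c𝟙 + ω_avg t 𝟙)‖ ≤ k‖θ(0) − (θ₀ + c𝟙)‖e^{−λt}`, `c = Σ_i D_i(θ_i(0) − θ₀,i)/Σ_i D_i`.
The proof follows the printed one: `L_LL(θ₀)` is nonsingular, the algebraic equations are solved
for the load velocities (`L_LL θ̇_L + L_LI θ̇_I = 0`), the reduced linearisation is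
`−D_I⁻¹L_red(θ₀)` with `L_red` again Laplacian-like (spectral lemma), and Lyapunov's indirect method
applies to the extension flow; a continuity (bootstrap) argument keeps `L_LL(θ(t))` invertible along
the solution.  MODEL: (CombinedKuraDroop) = (KuraDroop) at inverters + (PowerBal) at loads,
lossless, constant voltages; `ρ, k, λ` existential.
[cite: SimpsonporcoDorflerBullo2013, §3 Theorem 2 (i) («locally exponentially stable and unique
synchronized solution») and proof of (b) (held text p0007 L71–L77, p0008 L23–L49)] -/
theorem syncSolution_locally_expStable_loads (hY : ∀ i j, N.Yabs i j = N.Yabs j i)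
    (hD : ∀ i, 0 ≤ N.Dc i) (i₀ : N.Inv) {θ₀ : Fin n → ℝ} (hθ₀ : N.IsAuxEquilibrium θ₀)
    (hpsd : ∀ u : Fin n → ℝ, 0 ≤ ∑ i, u i * ∑ j, N.linWeight θ₀ i j * (u i - u j))
    (hker : ∀ u : Fin n → ℝ, ∑ i, u i * ∑ j, N.linWeight θ₀ i j * (u i - u j) = 0 →
      ∃ a : ℝ, u = fun _ => a) :
    ∃ ρ > 0, ∃ k > 0, ∃ lam > 0, ∀ θ : ℝ → Fin n → ℝ, (∀ t, N.IsSolutionAt θ t) → ‖θ 0 - θ₀‖ < ρ →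
      ∀ t : ℝ, 0 ≤ t →
        ‖θ t - fun i => θ₀ i + N.Dc ⬝ᵥ (θ 0 - θ₀) / (∑ i, N.Dc i) + N.avgFrequency * t‖
          ≤ k * ‖θ 0 - fun i => θ₀ i + N.Dc ⬝ᵥ (θ 0 - θ₀) / ∑ i, N.Dc i‖ * Real.exp (-lam * t) := by
  classical
  obtain ⟨ρ, hρ, k, hk, lam, hlam, H⟩ := kron_expStable_within_leaf hY hD i₀ hθ₀ hpsd hker
  have Hmod := kron_expStable_modRotation_of_within_leaf hD i₀ H
  have hDs : 0 < ∑ i, N.Dc i :=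
    lt_of_lt_of_le i₀.2 (Finset.single_le_sum (fun i _ => hD i) (Finset.mem_univ i₀.1))
  have hU0 : IsUnit (N.lapLL θ₀).det := isUnit_lapLL_det hker i₀
  obtain ⟨r, hr, hball⟩ := exists_ball_isUnit_lapLL hU0
  -- the radius: small enough for the estimate AND to keep `L_LL` invertible along the motion
  set ρ' : ℝ := min (ρ / 2) (r / (2 * k + 2)) with hρ'
  have hρ'pos : 0 < ρ' := lt_min (by positivity) (by positivity)
  have hρ'ρ : ρ' ≤ ρ / 2 := min_le_left _ _
  have hρ'r : (2 * k + 2) * ρ' ≤ r := by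
    have := min_le_right (ρ / 2) (r / (2 * k + 2))
    rw [← hρ'] at this
    calc (2 * k + 2) * ρ' ≤ (2 * k + 2) * (r / (2 * k + 2)) :=
          mul_le_mul_of_nonneg_left this (by positivity)
      _ = r := by field_simp
  refine ⟨ρ', hρ'pos, k, hk, lam, hlam, fun θ hsol h0 t ht => ?_⟩
  -- the frame curve and its properties
  set X : ℝ → Fin n → ℝ := fun s j => θ s j - N.avgFrequency * s with hXdef
  have hframe := fun s => frame_of_isSolutionAt (N := N) hD hsol s
  have hXderiv : ∀ s, ∃ V : Fin n → ℝ, HasDerivAt X V s ∧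
      ∀ i : N.Inv, V i.1 = N.mismatch (X s) i.1 / N.Dc i.1 := fun s => (hframe s).1
  have hXcons : ∀ (l : N.Load) (s : ℝ), N.mismatch (X s) l.1 = 0 := fun l s => (hframe s).2 l s
  have hXcont : Continuous X :=
    continuous_iff_continuousAt.2 fun s => (hXderiv s).choose_spec.1.continuousAt
  have hX0 : X 0 = θ 0 := by funext j; simp [hXdef]
  -- velocity = extension field wherever `L_LL(X s)` is invertible
  have hvel : ∀ s, IsUnit (N.lapLL (X s)).det → HasDerivAt X (N.kronField θ₀ (X s)) s := by
    intro s hUs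
    obtain ⟨V, hV, hVI⟩ := hXderiv s
    exact hasDerivAt_kronField_of_constraint hV hVI hXcons hUs
  -- the rotation selected by the conserved quantity
  set c : ℝ := N.Dc ⬝ᵥ (X 0 - θ₀) / ∑ i, N.Dc i with hcdef
  have hcle : |c| ≤ ‖X 0 - θ₀‖ := by
    rw [hcdef, abs_div, abs_of_pos hDs, div_le_iff₀ hDs]
    calc |N.Dc ⬝ᵥ (X 0 - θ₀)| ≤ (∑ i, N.Dc i) * ‖X 0 - θ₀‖ := abs_dc_dotProduct_le' hD _
      _ = ‖X 0 - θ₀‖ * ∑ i, N.Dc i := mul_comm _ _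
  have h0X : ‖X 0 - θ₀‖ < ρ' := by rw [hX0]; exact h0
  -- the estimate on any interval where `L_LL` stays invertible
  have hest : ∀ T : ℝ, (∀ s ∈ Icc 0 T, IsUnit (N.lapLL (X s)).det) →
      ∀ s ∈ Icc 0 T, ‖X s - fun i => θ₀ i + c‖
        ≤ k * ‖X 0 - fun i => θ₀ i + c‖ * Real.exp (-lam * s) := by
    intro T hT s hs
    have hsolF : ∀ s ∈ Icc 0 T, HasDerivWithinAt X (N.kronField θ₀ (X s)) (Icc 0 T) s :=
      fun s hs => (hvel s (hT s hs)).hasDerivWithinAt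
    exact Hmod X T hsolF (lt_of_lt_of_le h0X hρ'ρ) s hs
  have hbound0 : ‖X 0 - fun i => θ₀ i + c‖ ≤ 2 * ρ' := by
    have hdecomp : (X 0 - fun i => θ₀ i + c) = (X 0 - θ₀) - fun _ => c := by
      funext i; simp; ring
    rw [hdecomp]
    calc ‖(X 0 - θ₀) - fun _ : Fin n => c‖ ≤ ‖X 0 - θ₀‖ + ‖fun _ : Fin n => c‖ := norm_sub_le _ _
      _ ≤ ‖X 0 - θ₀‖ + |c| := by
          gcongr; exact (pi_norm_const_le c).trans (le_of_eq (Real.norm_eq_abs c))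
      _ ≤ 2 * ρ' := by linarith [h0X.le]
  have hsmall : ∀ T : ℝ, (∀ s ∈ Icc 0 T, IsUnit (N.lapLL (X s)).det) →
      ∀ s ∈ Icc 0 T, ‖X s - fun i => θ₀ i + c‖ ≤ 2 * k * ρ' := by
    intro T hT s hs
    have h1 := hest T hT s hs
    have hexp : Real.exp (-lam * s) ≤ 1 := Real.exp_le_one_iff.2 (by nlinarith [hs.1])
    calc ‖X s - fun i => θ₀ i + c‖ ≤ k * ‖X 0 - fun i => θ₀ i + c‖ * Real.exp (-lam * s) := h1
      _ ≤ k * ‖X 0 - fun i => θ₀ i + c‖ := mul_le_of_le_one_right (by positivity) hexp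
      _ ≤ k * (2 * ρ') := mul_le_mul_of_nonneg_left hbound0 hk.le
      _ = 2 * k * ρ' := by ring
  -- BOOTSTRAP: `L_LL(X s)` stays invertible for all `s ≥ 0`
  have hinv : ∀ s, 0 ≤ s → IsUnit (N.lapLL (X s)).det := by
    by_contra hcon
    push Not at hcon
    set S : Set ℝ := {s | 0 ≤ s ∧ ¬ IsUnit (N.lapLL (X s)).det} with hSdef
    have hSne : S.Nonempty := by obtain ⟨s, hs, hsU⟩ := hcon; exact ⟨s, hs, hsU⟩
    have hSbdd : BddBelow S := ⟨0, fun s hs => hs.1⟩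
    have hSclosed : IsClosed S := by
      have h1 : S = Set.Ici 0 ∩ (fun s => (N.lapLL (X s)).det) ⁻¹' {0} := by
        ext s
        simp only [hSdef, Set.mem_setOf_eq, Set.mem_inter_iff, Set.mem_Ici, Set.mem_preimage,
          Set.mem_singleton_iff, isUnit_iff_ne_zero, not_not]
      rw [h1]
      exact isClosed_Ici.inter (isClosed_singleton.preimage
        ((continuous_lapLL.matrix_det).comp hXcont))
    set T₀ : ℝ := sInf S with hT₀
    have hT₀mem : T₀ ∈ S := hSclosed.csInf_mem hSne hSbdd
    have hT₀nonneg : 0 ≤ T₀ := hT₀mem.1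
    have hbefore : ∀ s, 0 ≤ s → s < T₀ → IsUnit (N.lapLL (X s)).det := by
      intro s hs hsT
      by_contra hsU
      exact absurd (csInf_le hSbdd ⟨hs, hsU⟩) (not_le.2 hsT)
    -- at time 0 the matrix is invertible, so `T₀ > 0`
    have hU_X0 : IsUnit (N.lapLL (X 0)).det := by
      refine hball (X 0) c ?_
      calc ‖X 0 - fun j => θ₀ j + c‖ ≤ 2 * ρ' := hbound0
        _ < r := by nlinarith [hρ'r, hk]
    have hT₀pos : 0 < T₀ := by
      rcases hT₀nonneg.lt_or_eq with h | h
      · exact h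
      · exact absurd (h ▸ hU_X0) hT₀mem.2
    -- on `[0, T₀)` the estimate holds; pass to the limit `s → T₀⁻`
    have hle : ∀ s, 0 ≤ s → s < T₀ → ‖X s - fun i => θ₀ i + c‖ ≤ 2 * k * ρ' := by
      intro s hs hsT
      exact hsmall s (fun s' hs' => hbefore s' hs'.1 (lt_of_le_of_lt hs'.2 hsT)) s ⟨hs, le_rfl⟩
    have hlim : ‖X T₀ - fun i => θ₀ i + c‖ ≤ 2 * k * ρ' := by
      have htend : Tendsto (fun s => ‖X s - fun i => θ₀ i + c‖) (𝓝[<] T₀)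
          (𝓝 ‖X T₀ - fun i => θ₀ i + c‖) :=
        ((hXcont.sub continuous_const).norm.continuousAt).continuousWithinAt.tendsto
      refine le_of_tendsto htend ?_
      have hmem : Ioo 0 T₀ ∈ 𝓝[<] T₀ := Ioo_mem_nhdsLT hT₀pos
      filter_upwards [hmem] with s hs
      exact hle s hs.1.le hs.2
    have hU_T₀ : IsUnit (N.lapLL (X T₀)).det := by
      refine hball (X T₀) c ?_
      calc ‖X T₀ - fun j => θ₀ j + c‖ ≤ 2 * k * ρ' := hlim
        _ < r := by nlinarith [hρ'r, hk, hρ'pos]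
    exact hT₀mem.2 hU_T₀
  -- conclusion at time `t`
  have key := hest t (fun s hs => hinv s hs.1) t ⟨ht, le_rfl⟩
  have hshape : ∀ s, (X s - fun i => θ₀ i + c)
      = θ s - fun i => θ₀ i + N.Dc ⬝ᵥ (θ 0 - θ₀) / (∑ i, N.Dc i) + N.avgFrequency * s := by
    intro s; funext i; simp [hXdef, hcdef]; ring
  have hshape0 : (X 0 - fun i => θ₀ i + c)
      = θ 0 - fun i => θ₀ i + N.Dc ⬝ᵥ (θ 0 - θ₀) / ∑ i, N.Dc i := by
    rw [hshape 0]; funext i; simp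
  rw [hshape t, hshape0] at key
  exact key

/-- **Theorem 2 (i), stability clause with load nodes, printed hypotheses**: `θ₀ ∈ Δ_G(γ)`,
`γ < π/2` (line angles `< π/2` across coupled pairs), `a ≥ 0` with a connected coupling graph.
[cite: SimpsonporcoDorflerBullo2013, §3 Theorem 2 (i)] -/
theorem syncSolution_locally_expStable_loads_of_arc (hY : ∀ i j, N.Yabs i j = N.Yabs j i)
    (hD : ∀ i, 0 ≤ N.Dc i) (i₀ : N.Inv) (ha : ∀ i j, 0 ≤ N.a i j)
    (hconn : ClassicalModel.CouplingConnected N.a) {θ₀ : Fin n → ℝ} (hθ₀ : N.IsAuxEquilibrium θ₀)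
    (harc : ∀ i j, i ≠ j → 0 < N.a i j → |θ₀ i - θ₀ j| < Real.pi / 2) :
    ∃ ρ > 0, ∃ k > 0, ∃ lam > 0, ∀ θ : ℝ → Fin n → ℝ, (∀ t, N.IsSolutionAt θ t) → ‖θ 0 - θ₀‖ < ρ →
      ∀ t : ℝ, 0 ≤ t →
        ‖θ t - fun i => θ₀ i + N.Dc ⬝ᵥ (θ 0 - θ₀) / (∑ i, N.Dc i) + N.avgFrequency * t‖
          ≤ k * ‖θ 0 - fun i => θ₀ i + N.Dc ⬝ᵥ (θ 0 - θ₀) / ∑ i, N.Dc i‖ * Real.exp (-lam * t) := by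
  obtain ⟨hpsd, hker⟩ := posCurvature_of_arc ha hconn hY harc
  exact syncSolution_locally_expStable_loads hY hD i₀ hθ₀ hpsd hker

/-! ## §7 Theorem 2 (i) ⇔ (ii) WITH «locally exponentially stable and unique» — acyclic networks
WITH load nodes (the printed generality) -/

section Theorem2Loads

variable {m : ℕ} (E : EdgeList n m)

/-- **Theorem 2 as printed, acyclic networks of droop-controlled inverters AND loads**: let the edge
list represent the network (acyclic, positive weights), `ξ` the KCL flow (`P̃ = Bξ`), `|Y|` symmetric,
`a ≥ 0` with a connected coupling graph, `D ≥ 0` with at least one inverter.  Then flow feasibility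
`‖ξ‖ < w` edgewise (`Γ < 1`) is EQUIVALENT to: there is `γ ∈ [0, π/2[` and an (Aux)-equilibrium
`θ₀ ∈ Δ̄_G(γ)` which is unique in `Δ̄_G(γ)` modulo rotation and whose synchronized solution is
locally exponentially stable — every solution of the differential-algebraic closed loop starting
`ρ`-close converges exponentially to a rotation of it.
[cite: SimpsonporcoDorflerBullo2013, §3 Theorem 2 («The following two statements are equivalent:
(i) Synchronization … locally exponentially stable and unique synchronized solution
`t ↦ θ*(t) ∈ Δ̄_G(γ)` … (ii) Flow Feasibility … `Γ < 1`», held text p0007 L71–L77)] -/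
theorem flowFeasible_iff_exists_unique_expStable_sync_loads (hE : E.Represents N) (hA : E.Acyclic)
    (hw : ∀ ℓ, 0 < E.w ℓ) {ξ : Fin m → ℝ} (hξ : N.IsKCLFlow E ξ)
    (hY : ∀ i j, N.Yabs i j = N.Yabs j i) (ha : ∀ i j, 0 ≤ N.a i j)
    (hconn : ClassicalModel.CouplingConnected N.a) (hD : ∀ i, 0 ≤ N.Dc i) (i₀ : N.Inv) :
    E.FlowFeasible ξ ↔
      ∃ γ : ℝ, 0 ≤ γ ∧ γ < Real.pi / 2 ∧ ∃ θ₀ : Fin n → ℝ, E.InArc γ θ₀ ∧ N.IsAuxEquilibrium θ₀ ∧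
        (∀ θ' : Fin n → ℝ, E.InArc γ θ' → N.IsAuxEquilibrium θ' → ∃ c : ℝ, ∀ i, θ' i = θ₀ i + c) ∧
        (∃ ρ > 0, ∃ k > 0, ∃ lam > 0, ∀ θ : ℝ → Fin n → ℝ, (∀ t, N.IsSolutionAt θ t) →
          ‖θ 0 - θ₀‖ < ρ → ∀ t : ℝ, 0 ≤ t →
            ‖θ t - fun i => θ₀ i + N.Dc ⬝ᵥ (θ 0 - θ₀) / (∑ i, N.Dc i) + N.avgFrequency * t‖
              ≤ k * ‖θ 0 - fun i => θ₀ i + N.Dc ⬝ᵥ (θ 0 - θ₀) / ∑ i, N.Dc i‖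
                * Real.exp (-lam * t)) := by
  constructor
  · intro hF
    obtain ⟨γ, hγ0, hγ, θ₀, harc, hθ₀⟩ :=
      (N.flowFeasible_iff_exists_isAuxEquilibrium E hE hA hw hξ).1 hF
    have hlt : ∀ {θ : Fin n → ℝ}, E.InArc γ θ →
        ∀ i j, i ≠ j → 0 < N.a i j → |θ i - θ j| < Real.pi / 2 :=
      fun hθ i j hij hpos => (abs_sub_le_of_inArc E hE hθ hij hpos).trans_lt hγ
    refine ⟨γ, hγ0, hγ, θ₀, harc, hθ₀, fun θ' harc' hθ' => ?_, ?_⟩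
    · exact ClassicalModel.equilibrium_unique_mod_rotation N.a N.shiftedInjection
        (fun i j => a_symm hY i j) (fun i j _ => ha i j) hconn θ₀ θ' (fun i => hθ₀ i)
        (fun i => hθ' i) (fun i j hij hpos => (hlt harc i j hij hpos).le)
        (fun i j hij hpos => (hlt harc' i j hij hpos).le)
    · exact syncSolution_locally_expStable_loads_of_arc hY hD i₀ ha hconn hθ₀ (hlt harc)
  · rintro ⟨γ, hγ0, hγ, θ₀, harc, hθ₀, -, -⟩
    exact (N.flowFeasible_iff_exists_isAuxEquilibrium E hE hA hw hξ).2 ⟨γ, hγ0, hγ, θ₀, harc, hθ₀⟩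

end Theorem2Loads

end DroopNetwork

end Literature.MathematicalPhysics.PowerSystems

end
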